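import Mathlib.Analysis.Convex.Hull
import Mathlib.Analysis.Convex.Topology
import Mathlib.Analysis.SpecialFunctions.Trigonometric.Basic
import Mathlib.Analysis.Complex.Exponential
import Mathlib.Analysis.SpecialFunctions.Pow.Real
import Mathlib.Algebra.BigOperators.Field
import Mathlib.Analysis.SpecialFunctions.Complex.Arg
import Mathlib.Analysis.SpecialFunctions.Trigonometric.Bounds
import HarnessLib

/-!
# Osterwalder–Schrader II, Lemma 5.2: the bases of the inductive tubes exhaust `ℂ₊ᵏ`, with the rate (5.28)/(6.30)

Topic `Literature/MathematicalPhysics/QuantumFieldTheory`; support file (everything proved, no named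
facts) for the discharge of (A1) `OS1975_exists_timeContinuation` of
`Literature.MathematicalPhysics.QuantumFieldTheory.OSTimeContinuation` along Osterwalder–Schrader II
(Comm. Math. Phys. 42 (1975)), Ch. V.2 "Towards the Real World" and Ch. VI.2. There the
difference-variable Schwinger functions `S_k(ζ)` are continued in the `k` complex time
differences by an induction (A_N), (P_N) over regions `C_k^{(N)} ⊆ ℂ₊ᵏ` (analyticity of `S_k`) and
`D_n^{(N)}` (existence of the vectors `Ψ_n(x, ζ)`), (5.15)–(5.16); under `ζᵢ = e^{wᵢ}` these are
tubes whose bases `c_k^{(N)}, d_n^{(N)} ⊆ [−π/2, π/2]ᵏ` obey the recursion (5.23)–(5.25):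

* `c_k^{(N)}` = convex hull of `{(−ṽ', v, v'') | (0, v') ∈ d_n^{(N-1)}, (0, v'') ∈ d_m^{(N-1)}, |v| ≤ π/2, n + m − 1 = k}`
  (the tube theorem applied to `S_k(ζ̃̄', x' + x + τ, ζ) = ⟪Ψ_n(x', ζ'), e^{−τH} Ψ_m(x, ζ)⟫`, the
  free slot `v = arg(x' + x + τ)` sitting at the position of the split);
* `d_n^{(N)} = {(0, v) | (−ṽ, 0, v) ∈ c_{2n-1}^{(N)}}` (`‖Ψ_n(x, ζ)‖² = S_{2n-1}(ζ̃̄, 2x, ζ)`);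
* `c_k^{(0)} = {0}`, `d_n^{(0)} = {0}` (the real points),

and the continuation is complete once **Lemma 5.2** shows that these bases exhaust the open cube,
`⋃_N C_k^{(N)} = ℂ₊ᵏ`, quantitatively enough (Cor. 5.3, (5.28)) for the choice (6.30) of the level
`N(ζ)` to turn the bound (6.28), exponential in `N`, into the temperedness estimate (6.31) = (4.6).
This file proves exactly this combinatorial heart, in a form usable with any bookkeeping of the
induction:

* `osRho θ N i` — OS's `h^N_i` of (5.27) with the angle `θ < π/2` in place of `π/2` (which keeps
  all points in the *open* bases) and `h^N_0 := θ`: `h^{N+1}_{i+1} = (h^N_i + h^N_{i+1})/2`,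
  `h^0_{i+1} = 0` (closed form `θ · P[Bin(N, ½) ≥ i]`, not needed); monotonicity in `i` and `N`,
  the deficiency bound `θ − h^N_{i+1} ≤ θ (i+1)(N+1)^i 2^{-N}` (`sub_osRho_le`, (5.28)) and its
  consequence `exists_osRho_ge`: a level `N` with `2^N ≤ A_k / δ²` achieves `h^N_i ≥ θ(1 − δ)` for
  all `i ≤ k`;
* `IsOSBaseFamily C D` — any pair of families `C N k ⊆ ℝᵏ`, `D N j ⊆ ℝʲ` with the closure
  properties (5.23)–(5.25) (membership in `D` through the diagonal embedding `dEmbed u = (−ũ, 0, u)`,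
  `0 ∈ D 0 j`, convexity of the `C`'s, and the generators: reversed negated left part
  `splitLeft v p ∈ D N p`, `|v p| < π/2`, right part `splitRight v p ∈ D N (k-1-p)` ⟹
  `v ∈ C (N+1) k`); here `j = n − 1` counts the complex gaps of `Ψ_n`;
* `IsOSBaseFamily.vecOf_padFn_mem` — **the induction (5.26)–(5.27)**, in solid form: for all
  weights `|σ_m| ≤ 1` and paddings `s`, `(0^s, σ₀ h^N_1, …, σ_{t-1} h^N_t) ∈ D N (s + t)`; the step is
  the midpoint of the two generators carrying `±σ₀ θ` in the free slots at the offsets `±(s+1)`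
  from the centre of `(−w̃, 0, w)` (OS's two points of p. 296), which is where `h^N_0 = θ` enters;
* `IsOSBaseFamily.mem_D_of_abs_le`, `….mem_C_succ_of_abs_le`, `….mem_C_succ_of_forall_abs_le` —
  **Lemma 5.2 (a), (b) and Cor. 5.3**: the boxes `∏ [−h^N_{i+1}, h^N_{i+1}] ⊆ d_j^{(N)}`,
  `[−θ, θ] × ∏ [−h^N_{i+1}, h^N_{i+1}] ⊆ c_{k+1}^{(N+1)}`, the cube `max |v_i| ≤ h^N_k` in `c_{k+1}^{(N+1)}`;
* `IsOSBaseFamily.exists_level` — **the exhaustion with its rate**: `max |v_i| ≤ (π/2)(1 − δ)` ⟹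
  `v ∈ C (N+1) (k+1)` for some `N` with `2^N ≤ A_k / δ²`; `….exists_mem_C_of_forall_abs_lt` — the
  open cube `(−π/2, π/2)^{k+1}` is covered by `⋃_N C N (k+1)`;
* `osBaseC`, `osBaseD` — **OS's bases themselves** (the least such family, open version:
  strict `|v| < π/2`, no closures), `isOSBaseFamily_osBase`; they lie in the open cube
  (`osBaseC_subset_cube`), increase with `N` (`osBaseC_mono`), are open for `N ≥ 1`
  (`isOpen_osBaseC_succ`), the first level is the `ℓ¹`-ball `{∑ |v_i| < π/2}` of the first-stage
  domain (5.8) (`osBaseC_one`), `⋃_N c_{k+1}^{(N)}` is exactly the open cube (`iUnion_osBaseC`), and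
  **(6.30)**: for `ζ ∈ ℂ₊^{k+1}` the arguments `(arg ζ_i)_i` lie in `c_{k+1}^{(N+1)}` for some `N` with
  `2^N ≤ A_k (∑ |ζ_i| / Re ζ_i)²` (`osBaseC_exists_level_arg`, via `π/2 − |arg ζ| ≥ cos (arg ζ) = Re ζ/|ζ|`);
* **solidity** (OS II p. 296: "if `(v₁, …, v_k) ∈ c_k^{(N)}` then the whole hyperrectangle with
  corners `(±v₁, …, ±v_k)` is also contained in `c_k^{(N)}`", used on p. 294 for the polydiscs of
  (P_N)): the bases are closed under the coordinate reflections (`isReflClosed_osBaseC`,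
  `isReflClosed_osBaseD`), hence, being convex, under shrinking the moduli of the coordinates
  (`osBaseC_solid`, `osBaseD_solid`, from the general `solid_of_convex_of_isReflClosed`);
* the **generating sets** `osGen (osBaseD N) k` of (5.23) are star-shaped with respect to `0`
  (finite unions of convex pieces containing `0`, `starConvex_osGen_osBaseD`), open from level `2`
  on, and lie in `c_k^{(N+1)}` — the shape in which Bochner's tube theorem (tree:
  `Literature/Analysis/Complex/BochnerTubeFourier.lean`, star-shaped bases) extends a function
  holomorphic on the tube over `osGen` to the tube over its convex hull `c_k^{(N+1)}`.

## Faithfulness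

OS II state Lemma 5.2 with `ρ(i, N)` (= `h^N_i` at `θ = π/2`) and closed bases; the open version
with `θ < π/2` arbitrary is equivalent for the open regions actually used by the tube theorem and
is what an induction over genuine (open, connected, star-shaped) tube bases needs. The rate
proved here, `1 − h^N_{i+1}/θ ≤ (i+1)(N+1)^i 2^{-N} ≤ A_i 2^{-N/2}`, is (5.28)
(`ρ(i, N) ≥ (π/2)(1 − γ_i 2^{-N/2})`). The dimension `d + 1` of space-time plays no role here.

## References

* K. Osterwalder, R. Schrader, *Axioms for Euclidean Green's functions II*, Comm. Math. Phys.
  42 (1975) 281–305: §IV.2 p. 289 (the `C_k^{(r)}` increase to `ℂ₊ᵏ`), Ch. V.2 pp. 293–297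
  ((5.15)–(5.16), (5.22)–(5.28), Lemma 5.2, Cor. 5.3), Ch. VI.2 p. 303 ((6.28)–(6.31)).
  [OsterwalderSchraderCMP1975]

## Mathlib

`convexHull`, `convexHull_min`, `Convex.sum_mem`, `IsOpen.convexHull`,
`Real.pow_div_factorial_le_exp` (powers against `√2^N`), `pow_unbounded_of_one_lt`, `Nat.find`,
`Complex.cos_arg`, `Complex.abs_arg_lt_pi_div_two_iff`, `Real.sin_le`. Searched and absent in the
tree: any form of OS II Lemma 5.2 / (5.23)–(5.28) (`lean search 'Lemma 5.2'`, `'(5.27)'`,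
`'hyperrectangle'`, `'envelope of holomorphy'` in `QuantumFieldTheory/OS*`).
-/

noncomputable section

open Set

namespace Literature.MathematicalPhysics.QuantumFieldTheory.OSEnvelope

/-! ### The recursion (5.27) and its solution -/

/-- **Osterwalder–Schrader's `h^N_i`** (OS II (5.27)), with the angle `θ` in place of `π/2` and the
convention `h^N_0 = θ`: `osRho θ N 0 = θ`, `osRho θ 0 (i+1) = 0`,
`osRho θ (N+1) (i+1) = (osRho θ N i + osRho θ N (i+1)) / 2`. Closed form:
`osRho θ N i = θ · 2^{-N} ∑_{j ≥ i} (N choose j)`. [cite: OsterwalderSchraderCMP1975, Ch. V.2 eq. (5.27)] -/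
def osRho (θ : ℝ) : ℕ → ℕ → ℝ
  | _, 0 => θ
  | 0, _ + 1 => 0
  | N + 1, i + 1 => (osRho θ N i + osRho θ N (i + 1)) / 2

/-- `h^N_0 = θ` (the convention making the recursion uniform). [cite: OsterwalderSchraderCMP1975, Ch. V.2 eq. (5.27)] -/
@[simp] theorem osRho_zero_right (θ : ℝ) (N : ℕ) : osRho θ N 0 = θ := by
  cases N <;> rfl

/-- `h^0_{i+1} = 0` ((5.25): the induction starts from the real points). [cite: OsterwalderSchraderCMP1975, Ch. V.2 eq. (5.27)] -/
@[simp] theorem osRho_zero_succ (θ : ℝ) (i : ℕ) : osRho θ 0 (i + 1) = 0 := rfl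

/-- The recursion (5.27): `h^{N+1}_{i+1} = (h^N_i + h^N_{i+1}) / 2`. [cite: OsterwalderSchraderCMP1975, Ch. V.2 eq. (5.27)] -/
theorem osRho_succ_succ (θ : ℝ) (N i : ℕ) :
    osRho θ (N + 1) (i + 1) = (osRho θ N i + osRho θ N (i + 1)) / 2 := rfl

/-- The recursion in subtraction form: for `i ≥ 1`,
`osRho θ (N+1) i = (osRho θ N (i-1) + osRho θ N i) / 2`. [cite: OsterwalderSchraderCMP1975, Ch. V.2 eq. (5.27)] -/
theorem osRho_succ_of_pos (θ : ℝ) (N : ℕ) {i : ℕ} (hi : 0 < i) :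
    osRho θ (N + 1) i = (osRho θ N (i - 1) + osRho θ N i) / 2 := by
  obtain ⟨i, rfl⟩ := Nat.exists_eq_add_of_lt hi
  simp [osRho_succ_succ]

/-- `h^0_i = 0` for `i ≥ 1`. [cite: OsterwalderSchraderCMP1975, Ch. V.2 eq. (5.27)] -/
theorem osRho_zero_of_pos (θ : ℝ) {i : ℕ} (hi : 0 < i) : osRho θ 0 i = 0 := by
  obtain ⟨i, rfl⟩ := Nat.exists_eq_add_of_lt hi
  simp

/-- `0 ≤ osRho θ N i ≤ θ` for `θ ≥ 0`. [folklore] -/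
theorem osRho_nonneg {θ : ℝ} (hθ : 0 ≤ θ) : ∀ N i, 0 ≤ osRho θ N i
  | N, 0 => by simpa using hθ
  | 0, i + 1 => by simp
  | N + 1, i + 1 => by
    rw [osRho_succ_succ]
    have := osRho_nonneg hθ N i
    have := osRho_nonneg hθ N (i + 1)
    positivity

/-- `h^N_i ≤ θ` for `θ ≥ 0`. [folklore] -/
theorem osRho_le {θ : ℝ} (hθ : 0 ≤ θ) : ∀ N i, osRho θ N i ≤ θ
  | N, 0 => by simp
  | 0, i + 1 => by simpa using hθ
  | N + 1, i + 1 => by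
    rw [osRho_succ_succ]
    have := osRho_le hθ N i
    have := osRho_le hθ N (i + 1)
    linarith

/-- `osRho θ N` is decreasing in `i`. [folklore] -/
theorem osRho_succ_le {θ : ℝ} (hθ : 0 ≤ θ) : ∀ N i, osRho θ N (i + 1) ≤ osRho θ N i
  | 0, i => by simpa using osRho_nonneg hθ 0 i
  | N + 1, 0 => by
    rw [osRho_succ_succ, osRho_zero_right, osRho_zero_right]
    have := osRho_le hθ N 1
    linarith
  | N + 1, i + 1 => by
    rw [osRho_succ_succ, osRho_succ_succ]
    have := osRho_succ_le hθ N i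
    have := osRho_succ_le hθ N (i + 1)
    linarith

/-- `i ↦ h^N_i` is antitone. [folklore] -/
theorem osRho_antitone {θ : ℝ} (hθ : 0 ≤ θ) (N : ℕ) : Antitone (osRho θ N) :=
  antitone_nat_of_succ_le (osRho_succ_le hθ N)

/-- `osRho θ N i` is increasing in `N`. [folklore] -/
theorem osRho_le_succ {θ : ℝ} (hθ : 0 ≤ θ) : ∀ N i, osRho θ N i ≤ osRho θ (N + 1) i
  | N, 0 => by simp
  | N, i + 1 => by
    rw [osRho_succ_succ]
    have := osRho_succ_le hθ N i
    linarith

/-- `N ↦ h^N_i` is monotone. [folklore] -/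
theorem osRho_monotone {θ : ℝ} (hθ : 0 ≤ θ) (i : ℕ) : Monotone (fun N => osRho θ N i) :=
  monotone_nat_of_le_succ fun N => osRho_le_succ hθ N i

/-- Linearity in `θ`. [folklore] -/
theorem osRho_eq_mul : ∀ (θ : ℝ) (N i : ℕ), osRho θ N i = θ * osRho 1 N i
  | θ, N, 0 => by simp
  | θ, 0, i + 1 => by simp
  | θ, N + 1, i + 1 => by
    rw [osRho_succ_succ, osRho_succ_succ, osRho_eq_mul θ N i, osRho_eq_mul θ N (i + 1)]
    ring

/-- Bernoulli-type inequality `(a+1)^(i+1) ≥ a^(i+1) + (i+1) a^i` for `a ≥ 0`. [folklore] -/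
theorem pow_succ_add_mul_pow_le {a : ℝ} (ha : 0 ≤ a) :
    ∀ i : ℕ, a ^ (i + 1) + (i + 1) * a ^ i ≤ (a + 1) ^ (i + 1)
  | 0 => by norm_num
  | i + 1 => by
    have ih := pow_succ_add_mul_pow_le ha i
    have h1 : (a + 1) ^ (i + 1 + 1) = (a + 1) ^ (i + 1) * (a + 1) := pow_succ _ _
    have h2 : (a ^ (i + 1) + (i + 1) * a ^ i) * (a + 1) ≤ (a + 1) ^ (i + 1) * (a + 1) :=
      mul_le_mul_of_nonneg_right ih (by positivity)
    have h3 : a ^ (i + 1 + 1) + ((i + 1 : ℕ) + 1 : ℝ) * a ^ (i + 1) ≤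
        (a ^ (i + 1) + (i + 1) * a ^ i) * (a + 1) := by
      have : 0 ≤ (i + 1 : ℝ) * a ^ i := by positivity
      push_cast
      nlinarith [pow_succ a (i + 1), pow_succ a i]
    exact h3.trans (h2.trans_eq h1.symm)

/-- **The deficiency bound** `θ − h^N_{i+1} ≤ θ (i+1) (N+1)^i / 2^N`
(`θ − h^N_i = θ · P[Bin(N, ½) < i]`). [cite: OsterwalderSchraderCMP1975, Ch. V.2 eq. (5.28)] -/
theorem sub_osRho_le {θ : ℝ} (hθ : 0 ≤ θ) :
    ∀ N i : ℕ, θ - osRho θ N (i + 1) ≤ θ * ((i + 1) * (N + 1 : ℝ) ^ i / 2 ^ N)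
  | 0, i => by
    simp only [osRho_zero_succ, sub_zero, Nat.cast_zero, zero_add, one_pow, mul_one, pow_zero,
      div_one]
    have : (1 : ℝ) ≤ i + 1 := by linarith [i.cast_nonneg (α := ℝ)]
    nlinarith
  | N + 1, 0 => by
    have ih := sub_osRho_le hθ N 0
    rw [osRho_succ_succ, osRho_zero_right]
    simp only [Nat.cast_zero, zero_add, pow_zero, mul_one] at ih ⊢
    rw [pow_succ]
    have h2 : (0 : ℝ) < 2 ^ N := by positivity
    rw [div_mul_eq_div_div] 
    linarith [ih]
  | N + 1, i + 1 => by
    have ih1 := sub_osRho_le hθ N i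
    have ih2 := sub_osRho_le hθ N (i + 1)
    rw [osRho_succ_succ]
    have hB := pow_succ_add_mul_pow_le (a := (N + 1 : ℝ)) (by positivity) i
    have h2 : (0 : ℝ) < 2 ^ N := by positivity
    -- target: θ - (ρ N (i+1) + ρ N (i+2))/2 ≤ θ * ((i+2) (N+2)^(i+1) / 2^(N+1))
    have key : (i + 1) * (N + 1 : ℝ) ^ i + (i + 1 + 1) * (N + 1 : ℝ) ^ (i + 1) ≤
        (i + 1 + 1) * ((N + 1 : ℝ) + 1) ^ (i + 1) := by
      have hi : (0 : ℝ) ≤ i + 1 := by positivity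
      have hp : (0 : ℝ) ≤ (N + 1 : ℝ) ^ i := by positivity
      have hi2 : (0 : ℝ) ≤ i + 1 + 1 := by positivity
      have hB2 := mul_le_mul_of_nonneg_left hB hi2
      nlinarith [mul_nonneg (mul_nonneg hi hi) hp, hB2]
    have e1 : ((N + 1 : ℕ) : ℝ) + 1 = (N + 1 : ℝ) + 1 := by push_cast; ring
    have e2 : ((i + 1 : ℕ) : ℝ) + 1 = (i + 1 : ℝ) + 1 := by push_cast; ring
    rw [e1, e2, pow_succ (2 : ℝ) N]
    have lhs : θ - (osRho θ N (i + 1) + osRho θ N (i + 1 + 1)) / 2 =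
        ((θ - osRho θ N (i + 1)) + (θ - osRho θ N (i + 1 + 1))) / 2 := by ring
    rw [lhs]
    have step : ((θ - osRho θ N (i + 1)) + (θ - osRho θ N (i + 1 + 1))) / 2 ≤
        (θ * ((i + 1) * (N + 1 : ℝ) ^ i / 2 ^ N) +
          θ * (((i + 1 : ℕ) + 1 : ℝ) * (N + 1 : ℝ) ^ (i + 1) / 2 ^ N)) / 2 := by
      linarith
    refine step.trans ?_
    push_cast
    have hc : 0 ≤ θ / (2 ^ N * 2) := by positivity
    calc (θ * ((i + 1) * (N + 1 : ℝ) ^ i / 2 ^ N) +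
          θ * ((i + 1 + 1 : ℝ) * (N + 1 : ℝ) ^ (i + 1) / 2 ^ N)) / 2
        = θ / (2 ^ N * 2) * ((i + 1) * (N + 1 : ℝ) ^ i + (i + 1 + 1) * (N + 1 : ℝ) ^ (i + 1)) := by
          ring
      _ ≤ θ / (2 ^ N * 2) * ((i + 1 + 1) * ((N + 1 : ℝ) + 1) ^ (i + 1)) :=
          mul_le_mul_of_nonneg_left key hc
      _ = θ * ((i + 1 + 1) * (N + 1 + 1 : ℝ) ^ (i + 1) / (2 ^ N * 2)) := by ring

/-- `(N+1)^i ≤ i! (2 / log 2)^i · √2^(N+1)`: powers are dominated by `√2^N`. [folklore] -/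
theorem pow_le_factorial_mul_sqrt_two_pow (i N : ℕ) :
    (N + 1 : ℝ) ^ i ≤ (Nat.factorial i) * (2 / Real.log 2) ^ i * Real.sqrt 2 ^ (N + 1) := by
  have hlog : 0 < Real.log 2 := Real.log_pos one_lt_two
  set x : ℝ := (N + 1) * (Real.log 2 / 2) with hx
  have hx0 : 0 ≤ x := by positivity
  have h1 := Real.pow_div_factorial_le_exp x hx0 i
  have hexp : Real.exp x = Real.sqrt 2 ^ (N + 1) := by
    rw [hx, show (N + 1 : ℝ) * (Real.log 2 / 2) = ((N + 1 : ℕ) : ℝ) * (Real.log 2 / 2) by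
      push_cast; ring, Real.exp_nat_mul]
    congr 1
    rw [← Real.log_sqrt (by norm_num : (0:ℝ) ≤ 2), Real.exp_log (Real.sqrt_pos.2 (by norm_num))]
  have hfac : (0 : ℝ) < Nat.factorial i := by exact_mod_cast Nat.factorial_pos i
  have h2 : x ^ i ≤ (Nat.factorial i) * Real.sqrt 2 ^ (N + 1) := by
    rw [div_le_iff₀ hfac] at h1
    rw [hexp] at h1
    linarith
  have hxN : (N + 1 : ℝ) = x * (2 / Real.log 2) := by
    rw [hx]; field_simp
  rw [hxN, mul_pow]
  calc x ^ i * (2 / Real.log 2) ^ i ≤ ((Nat.factorial i) * Real.sqrt 2 ^ (N + 1)) * (2 / Real.log 2) ^ i :=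
        mul_le_mul_of_nonneg_right h2 (by positivity)
    _ = (Nat.factorial i) * (2 / Real.log 2) ^ i * Real.sqrt 2 ^ (N + 1) := by ring

/-- **The quantitative rate** (OS II (5.28), (6.30)): for every `k` there is `A ≥ 1` such that for
every `0 < δ ≤ 1` some level `N` with `2^N ≤ A / δ²` already has `h^N_i ≥ θ (1 − δ)` for all
`i ≤ k` and all `θ ≥ 0`. [cite: OsterwalderSchraderCMP1975, Ch. V.2 eq. (5.28); Ch. VI.2 eq. (6.30)] -/
theorem exists_osRho_ge (k : ℕ) : ∃ A : ℝ, 1 ≤ A ∧ ∀ δ : ℝ, 0 < δ → δ ≤ 1 →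
    ∃ N : ℕ, (2 : ℝ) ^ N ≤ A / δ ^ 2 ∧ ∀ θ : ℝ, 0 ≤ θ → ∀ i ≤ k, θ * (1 - δ) ≤ osRho θ N i := by
  -- the constant in the deficiency bound at index k: θ - ρ N k ≤ θ * B / √2^N
  obtain ⟨B, hB0, hB⟩ : ∃ B : ℝ, 0 < B ∧ ∀ N : ℕ, ∀ θ : ℝ, 0 ≤ θ →
      θ - osRho θ N k ≤ θ * (B / Real.sqrt 2 ^ N) := by
    cases k with
    | zero => exact ⟨1, one_pos, fun N θ hθ => by simp; positivity⟩
    | succ i =>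
      refine ⟨(i + 1) * ((Nat.factorial i) * (2 / Real.log 2) ^ i * Real.sqrt 2), by
        have := Real.log_pos one_lt_two; positivity, fun N θ hθ => ?_⟩
      refine (sub_osRho_le hθ N i).trans (mul_le_mul_of_nonneg_left ?_ hθ)
      have hs : (0 : ℝ) < Real.sqrt 2 ^ N := by positivity
      have h2N : (2 : ℝ) ^ N = Real.sqrt 2 ^ N * Real.sqrt 2 ^ N := by
        rw [← mul_pow, Real.mul_self_sqrt (by norm_num : (0:ℝ) ≤ 2)]
      rw [div_le_div_iff₀ (by positivity) hs, h2N]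
      have hp := pow_le_factorial_mul_sqrt_two_pow i N
      have hi : (0 : ℝ) ≤ i + 1 := by positivity
      calc (i + 1) * (N + 1 : ℝ) ^ i * Real.sqrt 2 ^ N
          ≤ (i + 1) * ((Nat.factorial i) * (2 / Real.log 2) ^ i * Real.sqrt 2 ^ (N + 1)) *
              Real.sqrt 2 ^ N := by gcongr
        _ = (i + 1) * ((Nat.factorial i) * (2 / Real.log 2) ^ i * Real.sqrt 2) *
              (Real.sqrt 2 ^ N * Real.sqrt 2 ^ N) := by ring
  refine ⟨max 1 (2 * B ^ 2), le_max_left _ _, fun δ hδ hδ1 => ?_⟩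
  -- choose N minimal with B / √2^N ≤ δ
  have hsq : (1 : ℝ) < Real.sqrt 2 := by
    rw [show (1:ℝ) = Real.sqrt 1 by simp]
    exact Real.sqrt_lt_sqrt (by norm_num) (by norm_num)
  have hex : ∃ N : ℕ, B / δ ≤ Real.sqrt 2 ^ N := pow_unbounded_of_one_lt (B / δ) hsq |>.imp
    fun N h => h.le
  classical
  let N := Nat.find hex
  have hN : B / δ ≤ Real.sqrt 2 ^ N := Nat.find_spec hex
  refine ⟨N, ?_, fun θ hθ i hi => ?_⟩
  · -- 2^N ≤ max 1 (2 B²) / δ²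
    have hδ2 : 0 < δ ^ 2 := by positivity
    rw [le_div_iff₀ hδ2]
    rcases Nat.eq_zero_or_pos N with hN0 | hNpos
    · rw [hN0, pow_zero, one_mul]
      calc δ ^ 2 ≤ 1 := by nlinarith
        _ ≤ max 1 (2 * B ^ 2) := le_max_left _ _
    · -- N = M + 1 with √2^M < B/δ
      obtain ⟨M, hM⟩ := Nat.exists_eq_add_of_lt hNpos
      have hM' : N = M + 1 := by omega
      have hlt : Real.sqrt 2 ^ M < B / δ := by
        have := Nat.find_min hex (show M < N by omega)
        simpa using this
      have h2M : (Real.sqrt 2 ^ M) ^ 2 = 2 ^ M := by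
        rw [← pow_mul, mul_comm, pow_mul, Real.sq_sqrt (by norm_num : (0:ℝ) ≤ 2)]
      have h2N : (2 : ℝ) ^ N = (Real.sqrt 2 ^ M) ^ 2 * 2 := by rw [h2M, hM', pow_succ]
      have hsM : 0 ≤ Real.sqrt 2 ^ M := by positivity
      have hBd : 0 < B / δ := by positivity
      have h3 : (Real.sqrt 2 ^ M) ^ 2 ≤ (B / δ) ^ 2 := by
        exact pow_le_pow_left₀ hsM hlt.le 2
      calc (2 : ℝ) ^ N * δ ^ 2 = (Real.sqrt 2 ^ M) ^ 2 * 2 * δ ^ 2 := by rw [h2N]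
        _ ≤ (B / δ) ^ 2 * 2 * δ ^ 2 := by gcongr
        _ = 2 * B ^ 2 := by field_simp
        _ ≤ max 1 (2 * B ^ 2) := le_max_right _ _
  · -- θ (1 - δ) ≤ ρ N i
    have h1 : osRho θ N k ≤ osRho θ N i := osRho_antitone hθ N hi
    have h2 := hB N θ hθ
    have h3 : θ * (B / Real.sqrt 2 ^ N) ≤ θ * δ := by
      apply mul_le_mul_of_nonneg_left _ hθ
      have hs : (0 : ℝ) < Real.sqrt 2 ^ N := by positivity
      rw [div_le_iff₀ hs]
      rw [div_le_iff₀ hδ] at hN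
      linarith [mul_comm δ (Real.sqrt 2 ^ N)]
    nlinarith


/-! ### Vectors given by a function of the index; splittings and the diagonal embedding -/

/-- The vector of length `n` with entries `f 0, …, f (n-1)`. [folklore] -/
def vecOf (n : ℕ) (f : ℕ → ℝ) : Fin n → ℝ := fun i => f i

/-- Entries of `vecOf`. [folklore] -/
@[simp] theorem vecOf_apply (n : ℕ) (f : ℕ → ℝ) (i : Fin n) : vecOf n f i = f i := rfl

/-- `vecOf n f` only depends on `f` below `n`. [folklore] -/
theorem vecOf_congr {n : ℕ} {f g : ℕ → ℝ} (h : ∀ i < n, f i = g i) : vecOf n f = vecOf n g :=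
  funext fun i => h i i.2

/-- The zero function gives the zero vector. [folklore] -/
theorem vecOf_zero_fn (n : ℕ) : vecOf n (fun _ => 0) = 0 := rfl

/-- Every vector is a `vecOf`. [folklore] -/
theorem vecOf_extend {n : ℕ} (v : Fin n → ℝ) :
    vecOf n (fun i => if h : i < n then v ⟨i, h⟩ else 0) = v := by
  funext i; simp [vecOf, i.2]

/-- **The reversed, negated left part** of `v` at the split position `p`:
`(−v_{p-1}, −v_{p-2}, …, −v_0)`. [cite: OsterwalderSchraderCMP1975, Ch. V.2 eq. (5.23)] -/
def splitLeft {k : ℕ} (v : Fin k → ℝ) (p : Fin k) : Fin p → ℝ :=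
  fun i => -v ⟨p - 1 - i, by have := p.2; omega⟩

/-- **The right part** of `v` at the split position `p`: `(v_{p+1}, …, v_{k-1})`. [cite: OsterwalderSchraderCMP1975, Ch. V.2 eq. (5.23)] -/
def splitRight {k : ℕ} (v : Fin k → ℝ) (p : Fin k) : Fin (k - 1 - p) → ℝ :=
  fun i => v ⟨p + 1 + i, by have := i.2; omega⟩

/-- **The diagonal embedding** `u ↦ (−ũ, 0, u) = (−u_{j-1}, …, −u_0, 0, u_0, …, u_{j-1})`
(OS II (5.24): the arguments of `(ζ̃̄, 2x, ζ)` in `‖Ψ_n(x, ζ)‖² = S_{2n-1}(ζ̃̄, 2x, ζ)`). [cite: OsterwalderSchraderCMP1975, Ch. V.2 eq. (5.24)] -/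
def dEmbed {j : ℕ} (u : Fin j → ℝ) : Fin (j + 1 + j) → ℝ :=
  fun i => if h : (i : ℕ) < j then -u ⟨j - 1 - i, by omega⟩
    else if h' : (i : ℕ) = j then 0 else u ⟨i - j - 1, by have := i.2; omega⟩

/-- The function describing `dEmbed (vecOf j g)`. [folklore] -/
def dEmbedFn (j : ℕ) (g : ℕ → ℝ) (i : ℕ) : ℝ :=
  if i < j then -g (j - 1 - i) else if i = j then 0 else g (i - j - 1)

/-- The diagonal embedding of a `vecOf` is the `vecOf` of `dEmbedFn`. [folklore] -/
theorem dEmbed_vecOf (j : ℕ) (g : ℕ → ℝ) :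
    dEmbed (vecOf j g) = vecOf (j + 1 + j) (dEmbedFn j g) := by
  funext i
  simp only [dEmbed, vecOf, dEmbedFn]
  split_ifs <;> rfl

/-- The diagonal embedding of `0` is `0`. [folklore] -/
@[simp] theorem dEmbed_zero (j : ℕ) : dEmbed (0 : Fin j → ℝ) = 0 := by
  funext i
  simp only [dEmbed, Pi.zero_apply, neg_zero]
  split_ifs <;> rfl

/-- The reversed negated left part of a `vecOf` (definitional). [folklore] -/
theorem splitLeft_vecOf {k : ℕ} (f : ℕ → ℝ) (p : Fin k) :
    splitLeft (vecOf k f) p = vecOf p (fun i => -f (p - 1 - i)) := rfl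

/-- The right part of a `vecOf` (definitional). [folklore] -/
theorem splitRight_vecOf {k : ℕ} (f : ℕ → ℝ) (p : Fin k) :
    splitRight (vecOf k f) p = vecOf (k - 1 - p) (fun i => f (p + 1 + i)) := rfl

/-- The left part of `0` is `0`. [folklore] -/
@[simp] theorem splitLeft_zero {k : ℕ} (p : Fin k) : splitLeft (0 : Fin k → ℝ) p = 0 := by
  funext i; simp [splitLeft]

/-- The right part of `0` is `0`. [folklore] -/
@[simp] theorem splitRight_zero {k : ℕ} (p : Fin k) : splitRight (0 : Fin k → ℝ) p = 0 := by
  funext i; simp [splitRight]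

/-! ### Families of tube bases closed under the Osterwalder–Schrader recursion -/

/-- **A family of tube bases closed under the recursion (5.23)–(5.25) of OS II.** `C N k ⊆ ℝᵏ`
is (a set containing) the base `c_k^{(N)}` of the tube onto which `log` maps the region
`C_k^{(N)} ⊆ ℂ₊ᵏ` of analyticity of `S_k` at the `N`-th induction step, and `D N j ⊆ ℝʲ` the base
`d^{(N)}` of the region `D^{(N)}` where the vectors `Ψ(x, ζ)`, `ζ ∈ ℂ₊ʲ`, exist (OS index
`D_n^{(N)}` by the number `n = j + 1` of fields): (i) `u ∈ d_j^{(N)} ⟺ (−ũ, 0, u) ∈ c_{2j+1}^{(N)}`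
((5.24): `‖Ψ(x, ζ)‖² = S_{2j+1}(ζ̃̄, 2x, ζ)`); (ii) `0 ∈ d^{(0)}` ((5.25)); (iii) the `c^{(N)}` are
convex (they are convex hulls, (5.23)); (iv) **generation** ((5.23) before taking the hull, i.e.
(5.15): `S_k(ζ̃̄', x' + x + τ, ζ) = ⟪Ψ(x', ζ'), e^{-τH} Ψ(x, ζ)⟫`): if the reversed negated left part
of `v` at a position `p` lies in `d_p^{(N)}`, `|v_p| < π/2`, and the right part lies in
`d_{k-1-p}^{(N)}`, then `v ∈ c_k^{(N+1)}`. Only these closure properties are used in the proof of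
Lemma 5.2, so it is stated for any such family (the least one is `osBaseC`/`osBaseD` below). [cite: OsterwalderSchraderCMP1975, Ch. V.2 eqs. (5.23)–(5.25)] -/
structure IsOSBaseFamily (C : ℕ → (k : ℕ) → Set (Fin k → ℝ)) (D : ℕ → (j : ℕ) → Set (Fin j → ℝ)) :
    Prop where
  mem_D_iff : ∀ (N j : ℕ) (u : Fin j → ℝ), u ∈ D N j ↔ dEmbed u ∈ C N (j + 1 + j)
  zero_mem : ∀ j : ℕ, (0 : Fin j → ℝ) ∈ D 0 j
  convex : ∀ N k : ℕ, Convex ℝ (C N k)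
  gen_mem : ∀ (N k : ℕ) (v : Fin k → ℝ) (p : Fin k), splitLeft v p ∈ D N p →
    |v p| < Real.pi / 2 → splitRight v p ∈ D N (k - 1 - p) → v ∈ C (N + 1) k

namespace IsOSBaseFamily

variable {C : ℕ → (k : ℕ) → Set (Fin k → ℝ)} {D : ℕ → (j : ℕ) → Set (Fin j → ℝ)}

/-- Transport of membership along an equality of lengths (the entries are unchanged). [folklore] -/
theorem vecOf_mem_D_iff (_hF : IsOSBaseFamily C D) {N a b : ℕ} (h : a = b) (f : ℕ → ℝ) :
    vecOf a f ∈ D N a ↔ vecOf b f ∈ D N b := by subst h; exact Iff.rfl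

/-- Transport of membership in `C` along an equality of lengths. [folklore] -/
theorem vecOf_mem_C_iff (_hF : IsOSBaseFamily C D) {N a b : ℕ} (h : a = b) (f : ℕ → ℝ) :
    vecOf a f ∈ C N a ↔ vecOf b f ∈ C N b := by subst h; exact Iff.rfl

/-- `0 ∈ d_j^{(N)}` for all `N`, `j`. [cite: OsterwalderSchraderCMP1975, Ch. V.2 eq. (5.25)] -/
theorem zero_mem_D (hF : IsOSBaseFamily C D) : ∀ N j : ℕ, (0 : Fin j → ℝ) ∈ D N j
  | 0, j => hF.zero_mem j
  | N + 1, j => by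
    rw [hF.mem_D_iff, dEmbed_zero]
    refine hF.gen_mem N (j + 1 + j) 0 ⟨j, by omega⟩ ?_ ?_ ?_
    · simpa using hF.zero_mem_D N j
    · simpa using Real.pi_pos
    · simpa using hF.zero_mem_D N (j + 1 + j - 1 - j)

/-- The padded pattern `(0, …, 0, σ₀ h^N_1, σ₁ h^N_2, …)` (`s` zeros) as a function of the index. [cite: OsterwalderSchraderCMP1975, Ch. V.2 eq. (5.26)] -/
def padFn (θ : ℝ) (N s : ℕ) (σ : ℕ → ℝ) (n : ℕ) : ℝ :=
  if n < s then 0 else σ (n - s) * osRho θ N (n - s + 1)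

/-- **The induction (5.26)–(5.27) of OS II, solid form.** For `0 ≤ θ < π/2`, every level `N`,
every padding `s` and all weights `|σ_m| ≤ 1`, the vector
`(0, …, 0, σ₀ h^N_1, σ₁ h^N_2, …, σ_{t-1} h^N_t) ∈ d_{s+t}^{(N)}` (OS: the points `w^N(s, t)`,
here with arbitrary weights in `[-1, 1]`, which makes the rectangles solid at once). The step
`N → N + 1` is the midpoint of the two generators with the free slot `±σ₀ θ` at the offsets
`±(s + 1)` from the centre of `(−w̃, 0, w)`. [cite: OsterwalderSchraderCMP1975, Ch. V.2 Lemma 5.2, eqs. (5.26)–(5.27)] -/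
theorem vecOf_padFn_mem (hF : IsOSBaseFamily C D) {θ : ℝ} (hθ0 : 0 ≤ θ) (hθ : θ < Real.pi / 2) :
    ∀ (N s t : ℕ) (σ : ℕ → ℝ), (∀ m, |σ m| ≤ 1) → vecOf (s + t) (padFn θ N s σ) ∈ D N (s + t) := by
  intro N
  induction N with
  | zero =>
    intro s t σ hσ
    have h0 : vecOf (s + t) (padFn θ 0 s σ) = 0 := by
      funext i
      simp only [vecOf, padFn, osRho_zero_succ, mul_zero, Pi.zero_apply]
      split_ifs <;> rfl
    rw [h0]
    exact hF.zero_mem _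
  | succ M ih =>
    intro s t σ hσ
    cases t with
    | zero =>
      have h0 : vecOf (s + 0) (padFn θ (M + 1) s σ) = 0 := by
        funext i
        have hi : (i : ℕ) < s := by have := i.2; omega
        simp [vecOf, padFn, hi]
      rw [h0]
      exact hF.zero_mem_D _ _
    | succ t' =>
      set t := t' + 1 with ht
      have htpos : 0 < t := by omega
      -- the two generators Q1, Q2 and the target P, as functions of the absolute index
      set ρ := osRho θ M with hρ
      let G1 : ℕ → ℝ := fun a =>
        if a < t then -(σ (t - 1 - a) * ρ (t - a))
        else if a ≤ 2 * s + t then 0 else σ (a - 2 * s - t - 1) * ρ (a - 2 * s - t - 1)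
      let G2 : ℕ → ℝ := fun a =>
        if a < t then -(σ (t - 1 - a) * ρ (t - 1 - a))
        else if a ≤ 2 * s + t then 0 else σ (a - 2 * s - t - 1) * ρ (a - 2 * s - t)
      set n := s + t + 1 + (s + t) with hn
      -- Q1 ∈ C (M+1) n
      have hQ1 : vecOf n G1 ∈ C (M + 1) n := by
        refine hF.gen_mem M n (vecOf n G1) ⟨s + s + 1 + t, by omega⟩ ?_ ?_ ?_
        · -- left part = padded pattern with 2s+1 zeros
          rw [splitLeft_vecOf]
          have h1 := ih (s + s + 1) t σ hσ
          convert h1 using 1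
          refine vecOf_congr fun i hi => ?_
          change i < s + s + 1 + t at hi
          simp only [padFn, G1]
          by_cases hi2 : i < s + s + 1
          · rw [if_pos hi2, if_neg (by omega), if_pos (by omega), neg_zero]
          · rw [if_neg hi2, if_pos (by omega), neg_neg]
            have e1 : t - 1 - (s + s + 1 + t - 1 - i) = i - (s + s + 1) := by omega
            have e2 : t - (s + s + 1 + t - 1 - i) = i - (s + s + 1) + 1 := by omega
            rw [e1, e2]
        · -- the free slot: σ₀ θ
          simp only [vecOf_apply, G1]
          rw [if_neg (by omega), if_neg (by omega)]
          have e : s + s + 1 + t - 2 * s - t - 1 = 0 := by omega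
          rw [e, hρ, osRho_zero_right, abs_mul]
          calc |σ 0| * |θ| ≤ 1 * |θ| := by gcongr; exact hσ 0
            _ = θ := by rw [one_mul, abs_of_nonneg hθ0]
            _ < Real.pi / 2 := hθ
        · -- right part = unpadded shifted pattern of length t - 1
          rw [splitRight_vecOf]
          have h1 := ih 0 t' (fun m => σ (m + 1)) (fun m => hσ _)
          rw [hF.vecOf_mem_D_iff (show 0 + t' = n - 1 - (s + s + 1 + t) by omega)] at h1
          convert h1 using 1
          refine vecOf_congr fun i hi => ?_
          simp only [padFn, G1]
          rw [if_neg (by omega), if_neg (by omega), if_neg (by omega)]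
          have e1 : s + s + 1 + t + 1 + i - 2 * s - t - 1 = i + 1 := by omega
          have e2 : i - 0 = i := by omega
          rw [e1, e2]
      -- Q2 ∈ C (M+1) n
      have hQ2 : vecOf n G2 ∈ C (M + 1) n := by
        refine hF.gen_mem M n (vecOf n G2) ⟨t - 1, by omega⟩ ?_ ?_ ?_
        · rw [splitLeft_vecOf]
          have h1 := ih 0 t' (fun m => σ (m + 1)) (fun m => hσ _)
          rw [hF.vecOf_mem_D_iff (show 0 + t' = t - 1 by omega)] at h1
          convert h1 using 1
          refine vecOf_congr fun i hi => ?_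
          change i < t - 1 at hi
          simp only [padFn, G2]
          rw [if_pos (by omega), if_neg (by omega), neg_neg]
          have e1 : t - 1 - (t - 1 - 1 - i) = i + 1 := by omega
          have e2 : i - 0 = i := by omega
          rw [e1, e2]
        · simp only [vecOf_apply, G2]
          rw [if_pos (by omega)]
          have e : t - 1 - (t - 1) = 0 := by omega
          rw [e, hρ, osRho_zero_right, abs_neg, abs_mul]
          calc |σ 0| * |θ| ≤ 1 * |θ| := by gcongr; exact hσ 0
            _ = θ := by rw [one_mul, abs_of_nonneg hθ0]
            _ < Real.pi / 2 := hθ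
        · rw [splitRight_vecOf]
          have h1 := ih (s + s + 1) t σ hσ
          rw [hF.vecOf_mem_D_iff (show s + s + 1 + t = n - 1 - (t - 1) by omega)] at h1
          convert h1 using 1
          refine vecOf_congr fun i hi => ?_
          simp only [padFn, G2]
          by_cases hi2 : i < s + s + 1
          · rw [if_pos hi2, if_neg (by omega), if_pos (by omega)]
          · rw [if_neg hi2, if_neg (by omega), if_neg (by omega)]
            have e1 : t - 1 + 1 + i - 2 * s - t - 1 = i - (s + s + 1) := by omega
            have e2 : t - 1 + 1 + i - 2 * s - t = i - (s + s + 1) + 1 := by omega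
            rw [e1, e2]
      -- the midpoint is the diagonal embedding of the level-(M+1) pattern
      have hmid : (1 / 2 : ℝ) • vecOf n G1 + (1 / 2 : ℝ) • vecOf n G2 ∈ C (M + 1) n :=
        hF.convex (M + 1) n hQ1 hQ2 (by norm_num) (by norm_num) (by norm_num)
      have heq : (1 / 2 : ℝ) • vecOf n G1 + (1 / 2 : ℝ) • vecOf n G2 =
          dEmbed (vecOf (s + t) (padFn θ (M + 1) s σ)) := by
        rw [dEmbed_vecOf]
        funext i
        have hi := i.2
        simp only [Pi.add_apply, Pi.smul_apply, vecOf_apply, smul_eq_mul, dEmbedFn, padFn, G1, G2]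
        by_cases hA : (i : ℕ) < t
        · rw [if_pos hA, if_pos hA, if_pos (by omega), if_neg (by omega)]
          have e1 : s + t - 1 - i - s = t - 1 - i := by omega
          rw [e1, osRho_succ_of_pos θ M (show 0 < t - 1 - (i : ℕ) + 1 by omega)]
          have e2 : t - 1 - i + 1 - 1 = t - 1 - i := by omega
          have e3 : t - 1 - (i : ℕ) + 1 = t - i := by omega
          rw [e2, e3, hρ]
          ring
        · rw [if_neg hA, if_neg hA]
          by_cases hB : (i : ℕ) ≤ 2 * s + t
          · rw [if_pos hB, if_pos hB]
            by_cases hB1 : (i : ℕ) < s + t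
            · rw [if_pos hB1, if_pos (by omega)]; ring
            · rw [if_neg hB1]
              by_cases hB2 : (i : ℕ) = s + t
              · rw [if_pos hB2]; ring
              · rw [if_neg hB2, if_pos (by omega)]; ring
          · rw [if_neg hB, if_neg hB, if_neg (by omega), if_neg (by omega), if_neg (by omega)]
            have e1 : (i : ℕ) - (s + t) - 1 - s = i - 2 * s - t - 1 := by omega
            rw [e1, osRho_succ_of_pos θ M (show 0 < (i : ℕ) - 2 * s - t - 1 + 1 by omega)]
            have e2 : (i : ℕ) - 2 * s - t - 1 + 1 - 1 = i - 2 * s - t - 1 := by omega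
            have e3 : (i : ℕ) - 2 * s - t - 1 + 1 = i - 2 * s - t := by omega
            rw [e2, e3, hρ]
            ring
      rw [hF.mem_D_iff, ← heq]
      exact hmid

/-- **OS II, Lemma 5.2 (a), solid form**: for `0 ≤ θ < π/2` the closed box
`∏ᵢ [−h^N_{i+1}, h^N_{i+1}]` lies in `d_j^{(N)}`. [cite: OsterwalderSchraderCMP1975, Ch. V.2 Lemma 5.2 (a)] -/
theorem mem_D_of_abs_le (hF : IsOSBaseFamily C D) {θ : ℝ} (hθ0 : 0 ≤ θ) (hθ : θ < Real.pi / 2)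
    {N j : ℕ} (u : Fin j → ℝ) (hu : ∀ i : Fin j, |u i| ≤ osRho θ N (i + 1)) : u ∈ D N j := by
  classical
  -- weights σ_m = u_m / h^N_{m+1} ∈ [-1, 1]
  let σ : ℕ → ℝ := fun m =>
    if h : m < j then (if osRho θ N (m + 1) = 0 then 0 else u ⟨m, h⟩ / osRho θ N (m + 1)) else 0
  have hσ : ∀ m, |σ m| ≤ 1 := by
    intro m
    simp only [σ]
    split_ifs with h1 h2
    · simp
    · have hpos : 0 < osRho θ N (m + 1) := lt_of_le_of_ne (osRho_nonneg hθ0 _ _) (Ne.symm h2)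
      rw [abs_div, abs_of_pos hpos, div_le_one hpos]
      exact hu ⟨m, h1⟩
    · simp
  have h1 := hF.vecOf_padFn_mem hθ0 hθ N 0 j σ hσ
  rw [hF.vecOf_mem_D_iff (zero_add j)] at h1
  convert h1 using 1
  funext i
  simp only [vecOf_apply, padFn, Nat.not_lt_zero, if_false, Nat.sub_zero, σ, dif_pos i.2]
  split_ifs with h2
  · have := hu i
    rw [h2, abs_nonpos_iff] at this
    rw [this, zero_mul]
  · rw [div_mul_cancel₀ _ h2]

/-- **OS II, Lemma 5.2 (b), solid form**: for `0 ≤ θ < π/2`, the box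
`[−θ, θ] × ∏ᵢ [−h^N_{i+1}, h^N_{i+1}]` lies in `c_{k+1}^{(N+1)}` ("part (b) follows from (a) and
the equation `S_k(ζ) = (Ω, Ψ_{k+1}(x, ζ))`": the generator with empty left part). [cite: OsterwalderSchraderCMP1975, Ch. V.2 Lemma 5.2 (b)] -/
theorem mem_C_succ_of_abs_le (hF : IsOSBaseFamily C D) {θ : ℝ} (hθ0 : 0 ≤ θ)
    (hθ : θ < Real.pi / 2) {N k : ℕ} (v : Fin (k + 1) → ℝ) (h0 : |v 0| ≤ θ)
    (hv : ∀ i : Fin k, |v i.succ| ≤ osRho θ N (i + 1)) : v ∈ C (N + 1) (k + 1) := by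
  refine hF.gen_mem N (k + 1) v 0 ?_ (h0.trans_lt hθ) ?_
  · exact hF.mem_D_of_abs_le hθ0 hθ _ fun i => i.elim0
  · refine hF.mem_D_of_abs_le hθ0 hθ _ fun i => ?_
    have h := hv ⟨i, by have := i.2; omega⟩
    simp only [splitRight]
    convert h using 3
    ext; simp; omega

/-- **OS II, Corollary 5.3 (cube form)**: if `max_i |v_i| ≤ h^N_k` then `v ∈ c_{k+1}^{(N+1)}`
(`h^N_i` decreases in `i` and `h^N_0 = θ`). [cite: OsterwalderSchraderCMP1975, Ch. V.2 Cor. 5.3] -/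
theorem mem_C_succ_of_forall_abs_le (hF : IsOSBaseFamily C D) {θ : ℝ} (hθ0 : 0 ≤ θ)
    (hθ : θ < Real.pi / 2) {N k : ℕ} (v : Fin (k + 1) → ℝ)
    (hv : ∀ i, |v i| ≤ osRho θ N k) : v ∈ C (N + 1) (k + 1) := by
  refine hF.mem_C_succ_of_abs_le hθ0 hθ v ((hv 0).trans ?_) fun i => (hv i.succ).trans ?_
  · simpa using osRho_antitone hθ0 N (Nat.zero_le k)
  · exact osRho_antitone hθ0 N (by have := i.2; omega)

/-- **The exhaustion `⋃_N C_k^{(N)} = ℂ₊ᵏ` with its rate** (OS II, Lemma 5.2, Cor. 5.3, (5.28) and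
the choice (6.30) of `N(ζ)`): for every `k` there is `A ≥ 1` such that every `v` with
`max_i |v_i| ≤ (π/2)(1 − δ)`, `0 < δ ≤ 1`, lies in `c_{k+1}^{(N+1)}` for some `N` with
`2^N ≤ A / δ²` — so along the induction the level needed at the arguments `v = arg ζ` grows only
logarithmically in `(1 − (2/π) max|arg ζ_i|)⁻¹ ≤ (π/2) max |ζ_i| / Re ζ_i`, which is what makes
the bound (6.28), exponential in `N`, polynomial in `∑ (Re ζ_i)⁻¹ |ζ_i|` ((6.31) = (4.6)). [cite: OsterwalderSchraderCMP1975, Ch. V.2 Cor. 5.3 and eq. (5.28); Ch. VI.2 eq. (6.30)] -/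
theorem exists_level (hF : IsOSBaseFamily C D) (k : ℕ) : ∃ A : ℝ, 1 ≤ A ∧
    ∀ (v : Fin (k + 1) → ℝ) (δ : ℝ), 0 < δ → δ ≤ 1 →
      (∀ i, |v i| ≤ Real.pi / 2 * (1 - δ)) → ∃ N : ℕ, v ∈ C (N + 1) (k + 1) ∧ (2 : ℝ) ^ N ≤ A / δ ^ 2 := by
  obtain ⟨A, hA1, hA⟩ := exists_osRho_ge k
  refine ⟨4 * A, by linarith, fun v δ hδ hδ1 hv => ?_⟩
  obtain ⟨N, hN, hρ⟩ := hA (δ / 2) (by positivity) (by linarith)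
  refine ⟨N, ?_, ?_⟩
  · -- θ = (π/2)(1-δ)/(1-δ/2)
    have hπ := Real.pi_pos
    have h1 : 0 < 1 - δ / 2 := by linarith
    set θ : ℝ := Real.pi / 2 * (1 - δ) / (1 - δ / 2) with hθdef
    have hθ0 : 0 ≤ θ := by
      rw [hθdef]; apply div_nonneg _ h1.le; apply mul_nonneg _ (by linarith); positivity
    have hθ : θ < Real.pi / 2 := by
      rw [hθdef, div_lt_iff₀ h1]
      nlinarith
    refine hF.mem_C_succ_of_forall_abs_le hθ0 hθ v fun i => (hv i).trans ?_
    have h2 := hρ θ hθ0 k le_rfl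
    have h3 : θ * (1 - δ / 2) = Real.pi / 2 * (1 - δ) := by
      rw [hθdef, div_mul_cancel₀ _ h1.ne']
    linarith
  · calc (2 : ℝ) ^ N ≤ A / (δ / 2) ^ 2 := hN
      _ = 4 * A / δ ^ 2 := by field_simp; ring

/-- **`⋃_N c_{k+1}^{(N)}` contains the open cube `(−π/2, π/2)^{k+1}`** (OS II: "`⋃_N C_k^{(N)} = ℂ₊ᵏ`,
which completes the analytic continuation", p. 294; consequence of Lemma 5.2). [cite: OsterwalderSchraderCMP1975, Ch. V.2 Lemma 5.2] -/
theorem exists_mem_C_of_forall_abs_lt (hF : IsOSBaseFamily C D) {k : ℕ} (v : Fin (k + 1) → ℝ)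
    (hv : ∀ i, |v i| < Real.pi / 2) : ∃ N : ℕ, v ∈ C (N + 1) (k + 1) := by
  obtain ⟨A, -, hA⟩ := hF.exists_level k
  -- the largest |v i|
  obtain ⟨i₀, -, hi₀⟩ := Finset.exists_max_image Finset.univ (fun i => |v i|) Finset.univ_nonempty
  have hπ := Real.pi_pos
  set δ : ℝ := 1 - |v i₀| / (Real.pi / 2) with hδdef
  have hδ : 0 < δ := by
    rw [hδdef, sub_pos, div_lt_one (by positivity)]; exact hv i₀
  have hδ1 : δ ≤ 1 := by
    rw [hδdef]; have : 0 ≤ |v i₀| / (Real.pi / 2) := by positivity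
    linarith
  obtain ⟨N, hN, -⟩ := hA v δ hδ hδ1 fun i => by
    have h1 := hi₀ i (Finset.mem_univ i)
    have h2 : Real.pi / 2 * (1 - δ) = |v i₀| := by rw [hδdef]; field_simp; ring
    rw [h2]; exact h1
  exact ⟨N, hN⟩

end IsOSBaseFamily


/-! ### The least such family: the bases (5.23)–(5.25) themselves -/

/-- **The generating set of the next level** ((5.23) before the convex hull): vectors whose
reversed negated left part at some position `p` and whose right part lie in the current `d`'s,
with `|v_p| < π/2` in the free slot. [cite: OsterwalderSchraderCMP1975, Ch. V.2 eq. (5.23)] -/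
def osGen (D : (j : ℕ) → Set (Fin j → ℝ)) (k : ℕ) : Set (Fin k → ℝ) :=
  {v | ∃ p : Fin k, splitLeft v p ∈ D p ∧ |v p| < Real.pi / 2 ∧ splitRight v p ∈ D (k - 1 - p)}

/-- **OS II's tube bases `c_k^{(N)}`** ((5.23), (5.25)), open version: `c_k^{(0)} = {0}` (the
real points, `C_k^{(0)} = ℝ₊ᵏ`), and `c_k^{(N+1)}` is the convex hull of the generating set built
from `d_j^{(N)} = {u | (−ũ, 0, u) ∈ c_{2j+1}^{(N)}}` ((5.24)). OS take closures of the bases and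
`|v| ≤ π/2`; here the sets are kept open (`isOpen_osBaseC_succ`), as needed for the tube
theorem, which changes nothing in Lemma 5.2. [cite: OsterwalderSchraderCMP1975, Ch. V.2 eqs. (5.23)–(5.25)] -/
def osBaseC : ℕ → (k : ℕ) → Set (Fin k → ℝ)
  | 0 => fun _ => {0}
  | N + 1 => fun k =>
    convexHull ℝ (osGen (fun j => {u : Fin j → ℝ | dEmbed u ∈ osBaseC N (j + 1 + j)}) k)

/-- **OS II's tube bases `d_j^{(N)} = {u | (−ũ, 0, u) ∈ c_{2j+1}^{(N)}}`** ((5.24)), for the vectors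
`Ψ(x, ζ)`, `ζ ∈ ℂ₊ʲ`. [cite: OsterwalderSchraderCMP1975, Ch. V.2 eq. (5.24)] -/
def osBaseD (N j : ℕ) : Set (Fin j → ℝ) := {u | dEmbed u ∈ osBaseC N (j + 1 + j)}

/-- Level `0`: the real points, `c_k^{(0)} = {0}` ((5.25)). [cite: OsterwalderSchraderCMP1975, Ch. V.2 eq. (5.25)] -/
theorem osBaseC_zero (k : ℕ) : osBaseC 0 k = {0} := rfl

/-- Level `N + 1`: the convex hull of the generating set ((5.23)). [cite: OsterwalderSchraderCMP1975, Ch. V.2 eq. (5.23)] -/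
theorem osBaseC_succ (N k : ℕ) : osBaseC (N + 1) k = convexHull ℝ (osGen (osBaseD N) k) := rfl

/-- Membership in `d_j^{(N)}` ((5.24)). [cite: OsterwalderSchraderCMP1975, Ch. V.2 eq. (5.24)] -/
theorem mem_osBaseD_iff {N j : ℕ} (u : Fin j → ℝ) :
    u ∈ osBaseD N j ↔ dEmbed u ∈ osBaseC N (j + 1 + j) := Iff.rfl

/-- **OS's bases form an OS base family** (so Lemma 5.2, Cor. 5.3 and the exhaustion apply to
them: `isOSBaseFamily_osBase.exists_level` etc.). [cite: OsterwalderSchraderCMP1975, Ch. V.2 eqs. (5.23)–(5.25)] -/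
theorem isOSBaseFamily_osBase : IsOSBaseFamily osBaseC osBaseD where
  mem_D_iff _ _ _ := Iff.rfl
  zero_mem j := by
    show dEmbed (0 : Fin j → ℝ) ∈ osBaseC 0 (j + 1 + j)
    rw [dEmbed_zero, osBaseC_zero]
    exact mem_singleton _
  convex N k := by
    cases N with
    | zero => exact convex_singleton 0
    | succ N => exact convex_convexHull ℝ _
  gen_mem N k v p h1 h2 h3 := subset_convexHull ℝ _ ⟨p, h1, h2, h3⟩

/-- The right block of the diagonal embedding returns the vector. [folklore] -/
theorem dEmbed_apply_right {j : ℕ} (u : Fin j → ℝ) (i : Fin j) :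
    dEmbed u ⟨j + 1 + i, by omega⟩ = u i := by
  have hi := i.2
  simp only [dEmbed]
  split_ifs with h1 h2
  · exfalso; omega
  · exfalso; omega
  · congr 1; ext; dsimp only; omega

/-- The left block of the diagonal embedding is the reversed negated vector. [folklore] -/
theorem dEmbed_apply_left {j : ℕ} (u : Fin j → ℝ) (i : Fin j) :
    dEmbed u ⟨j - 1 - i, by omega⟩ = -u i := by
  have hi := i.2
  simp only [dEmbed]
  split_ifs with h1 h2
  · congr 2; ext; dsimp only; omega
  · exfalso; omega
  · exfalso; omega

/-- The diagonal embedding is injective at `0`. [folklore] -/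
theorem dEmbed_eq_zero_iff {j : ℕ} (u : Fin j → ℝ) : dEmbed u = 0 ↔ u = 0 := by
  refine ⟨fun h => funext fun i => ?_, fun h => by rw [h, dEmbed_zero]⟩
  rw [← dEmbed_apply_right u i, h]; rfl

/-- `d_j^{(0)} = {0}`. [cite: OsterwalderSchraderCMP1975, Ch. V.2 eq. (5.25)] -/
theorem osBaseD_zero (j : ℕ) : osBaseD 0 j = {0} := by
  ext u
  rw [mem_osBaseD_iff, osBaseC_zero, mem_singleton_iff, mem_singleton_iff, dEmbed_eq_zero_iff]

/-- The open cube `{max |v_i| < c}` is convex. [folklore] -/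
theorem convex_cube (k : ℕ) (c : ℝ) : Convex ℝ {v : Fin k → ℝ | ∀ i, |v i| < c} := by
  intro x hx y hy a b ha hb hab i
  simp only [Pi.add_apply, Pi.smul_apply, smul_eq_mul]
  calc |a * x i + b * y i| ≤ |a * x i| + |b * y i| := abs_add_le _ _
    _ = a * |x i| + b * |y i| := by rw [abs_mul, abs_mul, abs_of_nonneg ha, abs_of_nonneg hb]
    _ < c := by
      rcases ha.eq_or_lt with rfl | ha'
      · simp only [zero_add] at hab; subst hab; simpa using hy i
      · have h1 := mul_lt_mul_of_pos_left (hx i) ha'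
        have h2 := mul_le_mul_of_nonneg_left (hy i).le hb
        calc a * |x i| + b * |y i| < a * c + b * c := add_lt_add_of_lt_of_le h1 h2
          _ = c := by rw [← add_mul, hab, one_mul]

/-- **All bases lie in the open cube `(−π/2, π/2)ᵏ`** (so `ζ = e^w` with `Im w ∈ c_k^{(N)}` stays
in `ℂ₊ᵏ`, (5.22)). [cite: OsterwalderSchraderCMP1975, Ch. V.2 eq. (5.22)] -/
theorem osBaseC_subset_cube : ∀ N k : ℕ, osBaseC N k ⊆ {v | ∀ i, |v i| < Real.pi / 2}
  | 0, k => by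
    intro v hv i
    rw [osBaseC_zero, mem_singleton_iff] at hv
    simp [hv, Real.pi_pos]
  | N + 1, k => by
    rw [osBaseC_succ]
    refine convexHull_min ?_ (convex_cube k _)
    rintro v ⟨p, h1, h2, h3⟩ i
    rcases lt_trichotomy (i : ℕ) p with hi | hi | hi
    · -- coordinate in the left part
      have hc := osBaseC_subset_cube N _ h1 ⟨p + 1 + (p - 1 - i), by omega⟩
      rw [dEmbed_apply_right (splitLeft v p) ⟨p - 1 - i, by omega⟩] at hc
      simp only [splitLeft, abs_neg] at hc
      have hi' := i.2
      convert hc using 3; ext; dsimp only; omega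
    · have : i = p := Fin.ext hi
      rw [this]; exact h2
    · have hp := p.2
      have hi' := i.2
      have hc := osBaseC_subset_cube N _ h3 ⟨(k - 1 - p) + 1 + (i - p - 1), by omega⟩
      rw [dEmbed_apply_right (splitRight v p) ⟨i - p - 1, by omega⟩] at hc
      simp only [splitRight] at hc
      convert hc using 3; ext; dsimp only; omega

/-- The `d`-bases lie in the open cube `(−π/2, π/2)ʲ`. [cite: OsterwalderSchraderCMP1975, Ch. V.2 eq. (5.22)] -/
theorem osBaseD_subset_cube (N j : ℕ) : osBaseD N j ⊆ {u | ∀ i, |u i| < Real.pi / 2} := by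
  intro u hu i
  have hc := osBaseC_subset_cube N _ hu ⟨j + 1 + i, by omega⟩
  rwa [dEmbed_apply_right] at hc

/-- The generating sets increase with the `d`'s. [folklore] -/
theorem osGen_mono {D D' : (j : ℕ) → Set (Fin j → ℝ)} (h : ∀ j, D j ⊆ D' j) (k : ℕ) :
    osGen D k ⊆ osGen D' k := by
  rintro v ⟨p, h1, h2, h3⟩
  exact ⟨p, h _ h1, h2, h _ h3⟩

/-- **The bases increase with the level**: `c_k^{(N)} ⊆ c_k^{(N+1)}` for `k ≥ 1` (OS II p. 289:
"the subsets `C_k^{(r)}` are increasing"). [cite: OsterwalderSchraderCMP1975, §IV.2 (after Thm. 4.2)] -/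
theorem osBaseC_subset_succ : ∀ (N : ℕ) {k : ℕ}, 0 < k → osBaseC N k ⊆ osBaseC (N + 1) k
  | 0, k, hk => by
    intro v hv
    rw [osBaseC_zero, mem_singleton_iff] at hv
    subst hv
    rw [osBaseC_succ]
    refine subset_convexHull ℝ _ ⟨⟨0, hk⟩, ?_, by simpa using Real.pi_pos, ?_⟩
    · rw [splitLeft_zero]; exact isOSBaseFamily_osBase.zero_mem _
    · rw [splitRight_zero]; exact isOSBaseFamily_osBase.zero_mem _
  | N + 1, k, _ => by
    rw [osBaseC_succ, osBaseC_succ]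
    refine convexHull_mono (osGen_mono (fun j u hu => ?_) k)
    exact osBaseC_subset_succ N (by omega) hu

/-- `N ↦ c_k^{(N)}` is monotone (`k ≥ 1`). [cite: OsterwalderSchraderCMP1975, §IV.2 (after Thm. 4.2)] -/
theorem osBaseC_mono {k : ℕ} (hk : 0 < k) : Monotone fun N => osBaseC N k :=
  monotone_nat_of_le_succ fun N => osBaseC_subset_succ N hk

/-- `N ↦ d_j^{(N)}` is monotone. [cite: OsterwalderSchraderCMP1975, §IV.2 (after Thm. 4.2)] -/
theorem osBaseD_mono (j : ℕ) : Monotone fun N => osBaseD N j :=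
  fun _ _ h u hu => osBaseC_mono (by omega) h hu

/-- A coordinate vector `c e_p` with `|c| < π/2` is a generator of level `1`. [cite: OsterwalderSchraderCMP1975, Ch. V.2 eqs. (5.23), (5.25)] -/
theorem single_mem_osGen_osBaseD_zero {k : ℕ} (p : Fin k) {c : ℝ} (hc : |c| < Real.pi / 2) :
    Pi.single p c ∈ osGen (osBaseD 0) k := by
  refine ⟨p, ?_, by simpa using hc, ?_⟩
  · rw [osBaseD_zero, mem_singleton_iff]
    funext i
    have hi := i.2
    simp only [splitLeft, Pi.zero_apply, neg_eq_zero]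
    exact Pi.single_eq_of_ne (Fin.ne_of_val_ne (by dsimp only; omega)) _
  · rw [osBaseD_zero, mem_singleton_iff]
    funext i
    have hi := i.2
    simp only [splitRight, Pi.zero_apply]
    exact Pi.single_eq_of_ne (Fin.ne_of_val_ne (by dsimp only; omega)) _

/-- A generator of level `1` is a coordinate vector: all coordinates but the free one vanish. [cite: OsterwalderSchraderCMP1975, Ch. V.2 eqs. (5.23), (5.25)] -/
theorem eq_single_of_mem_osGen_osBaseD_zero {k : ℕ} {v : Fin k → ℝ}
    (hv : v ∈ osGen (osBaseD 0) k) : ∃ p : Fin k, |v p| < Real.pi / 2 ∧ v = Pi.single p (v p) := by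
  obtain ⟨p, h1, h2, h3⟩ := hv
  rw [osBaseD_zero, mem_singleton_iff] at h1 h3
  refine ⟨p, h2, funext fun i => ?_⟩
  have hp := p.2
  have hi' := i.2
  rcases lt_trichotomy (i : ℕ) p with hi | hi | hi
  · have h := congrFun h1 ⟨p - 1 - i, by omega⟩
    simp only [splitLeft, Pi.zero_apply, neg_eq_zero] at h
    rw [Pi.single_eq_of_ne (Fin.ne_of_val_ne (by omega))]
    convert h using 2; ext; dsimp only; omega
  · have : i = p := Fin.ext hi
    subst this; simp
  · have h := congrFun h3 ⟨i - p - 1, by omega⟩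
    simp only [splitRight, Pi.zero_apply] at h
    rw [Pi.single_eq_of_ne (Fin.ne_of_val_ne (by omega))]
    convert h using 2; ext; dsimp only; omega

/-- **The first level is the `ℓ¹`-ball**: `c_k^{(1)} = {v | ∑ᵢ |vᵢ| < π/2}` (`k ≥ 1`) — the base
`{w | ∑ |arg wᵢ| < π/2}` of the first-stage domain (5.8) of OS II, obtained there from the flat
tubes by the Malgrange–Zerner theorem. [cite: OsterwalderSchraderCMP1975, Ch. V.1 eq. (5.8)] -/
theorem osBaseC_one {k : ℕ} (hk : 0 < k) :
    osBaseC 1 k = {v | ∑ i, |v i| < Real.pi / 2} := by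
  rw [osBaseC_succ]
  apply Subset.antisymm
  · -- the ℓ¹-ball is convex and contains the generators
    refine convexHull_min (fun v hv => ?_) ?_
    · obtain ⟨p, hp, hv⟩ := eq_single_of_mem_osGen_osBaseD_zero hv
      show ∑ i, |v i| < Real.pi / 2
      rw [hv]
      rw [Finset.sum_eq_single p (fun i _ hi => by simp [hi]) (by simp)]
      simpa using hp
    · intro x hx y hy a b ha hb hab
      show ∑ i, |(a • x + b • y) i| < Real.pi / 2
      have hx' : ∑ i, |x i| < Real.pi / 2 := hx
      have hy' : ∑ i, |y i| < Real.pi / 2 := hy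
      calc ∑ i, |(a • x + b • y) i| ≤ ∑ i, (a * |x i| + b * |y i|) := by
            refine Finset.sum_le_sum fun i _ => ?_
            simp only [Pi.add_apply, Pi.smul_apply, smul_eq_mul]
            calc |a * x i + b * y i| ≤ |a * x i| + |b * y i| := abs_add_le _ _
              _ = a * |x i| + b * |y i| := by
                rw [abs_mul, abs_mul, abs_of_nonneg ha, abs_of_nonneg hb]
        _ = a * ∑ i, |x i| + b * ∑ i, |y i| := by
            rw [Finset.sum_add_distrib, Finset.mul_sum, Finset.mul_sum]
        _ < Real.pi / 2 := by
            rcases ha.eq_or_lt with rfl | ha'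
            · simp only [zero_add] at hab; subst hab; simpa using hy'
            · have h1 := mul_lt_mul_of_pos_left hx' ha'
              have h2 := mul_le_mul_of_nonneg_left hy'.le hb
              calc a * ∑ i, |x i| + b * ∑ i, |y i| < a * (Real.pi / 2) + b * (Real.pi / 2) :=
                    add_lt_add_of_lt_of_le h1 h2
                _ = Real.pi / 2 := by rw [← add_mul, hab, one_mul]
  · -- a point of the ball is a convex combination of generators `± S e_i`, `S = ∑ |v_i|`
    intro v hv
    have hvS : ∑ i, |v i| < Real.pi / 2 := hv
    set S := ∑ i, |v i| with hS
    have hS0 : 0 ≤ S := Finset.sum_nonneg fun i _ => abs_nonneg _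
    rcases hS0.eq_or_lt with hS0' | hSpos
    · -- v = 0
      have hv0 : v = 0 := by
        funext i
        have := (Finset.sum_eq_zero_iff_of_nonneg fun i _ => abs_nonneg (v i)).1 hS0'.symm i
          (Finset.mem_univ i)
        simpa using this
      rw [hv0, ← Pi.single_zero (⟨0, hk⟩ : Fin k)]
      exact subset_convexHull ℝ _
        (single_mem_osGen_osBaseD_zero _ (by simpa using Real.pi_pos))
    · classical
      -- weights and points
      let w : Fin k → ℝ := fun i => |v i| / S
      let Q : Fin k → (Fin k → ℝ) := fun i =>
        if v i = 0 then 0 else Pi.single i (S / |v i| * v i)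
      have hQ : ∀ i, Q i ∈ convexHull ℝ (osGen (osBaseD 0) k) := by
        intro i
        refine subset_convexHull ℝ _ ?_
        simp only [Q]
        split_ifs with h
        · rw [← Pi.single_zero i]
          exact single_mem_osGen_osBaseD_zero _ (by simpa using Real.pi_pos)
        · refine single_mem_osGen_osBaseD_zero _ ?_
          rw [abs_mul, abs_div, abs_of_pos hSpos, abs_abs, div_mul_cancel₀ _ (abs_ne_zero.2 h)]
          exact hvS
      have hw0 : ∀ i ∈ Finset.univ, 0 ≤ w i := fun i _ => div_nonneg (abs_nonneg _) hS0
      have hw1 : ∑ i, w i = 1 := by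
        simp only [w]
        rw [← Finset.sum_div, div_self hSpos.ne']
      have hcomb := (convex_convexHull ℝ (osGen (osBaseD 0) k)).sum_mem hw0 hw1 fun i _ => hQ i
      convert hcomb using 1
      funext m
      simp only [Finset.sum_apply, Pi.smul_apply, smul_eq_mul, w, Q]
      rw [Finset.sum_eq_single m]
      · split_ifs with h
        · simp [h]
        · rw [Pi.single_eq_same]
          field_simp
      · intro i _ hi
        split_ifs with h
        · simp
        · rw [Pi.single_eq_of_ne (Ne.symm hi), mul_zero]
      · simp

/-- `splitLeft · p` is continuous. [folklore] -/
theorem continuous_splitLeft {k : ℕ} (p : Fin k) : Continuous fun v : Fin k → ℝ => splitLeft v p :=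
  continuous_pi fun _ => (continuous_apply _).neg

/-- `splitRight · p` is continuous. [folklore] -/
theorem continuous_splitRight {k : ℕ} (p : Fin k) :
    Continuous fun v : Fin k → ℝ => splitRight v p :=
  continuous_pi fun _ => continuous_apply _

/-- The diagonal embedding is continuous. [folklore] -/
theorem continuous_dEmbed (j : ℕ) : Continuous (dEmbed (j := j)) := by
  refine continuous_pi fun i => ?_
  simp only [dEmbed]
  split_ifs
  · exact (continuous_apply _).neg
  · exact continuous_const
  · exact continuous_apply _

/-- The generating set as a finite union of intersections of preimages. [folklore] -/
theorem osGen_eq_iUnion (D : (j : ℕ) → Set (Fin j → ℝ)) (k : ℕ) :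
    osGen D k = ⋃ p : Fin k, ((fun v => splitLeft v p) ⁻¹' D p ∩ {v | |v p| < Real.pi / 2}) ∩
      (fun v => splitRight v p) ⁻¹' D (k - 1 - p) := by
  ext v
  simp only [osGen, mem_setOf_eq, mem_iUnion, mem_inter_iff, mem_preimage]
  exact ⟨fun ⟨p, h1, h2, h3⟩ => ⟨p, ⟨h1, h2⟩, h3⟩, fun ⟨p, ⟨h1, h2⟩, h3⟩ => ⟨p, h1, h2, h3⟩⟩

/-- **The bases `c_k^{(N)}`, `N ≥ 1`, are open** (bases of genuine tube domains). [cite: OsterwalderSchraderCMP1975, Ch. V.2 eq. (5.22)] -/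
theorem isOpen_osBaseC_succ : ∀ N k : ℕ, IsOpen (osBaseC (N + 1) k)
  | 0, k => by
    rcases Nat.eq_zero_or_pos k with rfl | hk
    · rw [osBaseC_succ]
      have : osGen (osBaseD 0) 0 = ∅ := by
        ext v; simp only [osGen, mem_setOf_eq, mem_empty_iff_false, iff_false]
        rintro ⟨p, -⟩; exact p.elim0
      rw [this, convexHull_empty]
      exact isOpen_empty
    · rw [osBaseC_one hk]
      exact isOpen_lt (continuous_finsetSum _ fun i _ => (continuous_apply i).abs)
        continuous_const
  | N + 1, k => by
    rw [osBaseC_succ]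
    refine IsOpen.convexHull ?_
    rw [osGen_eq_iUnion]
    refine isOpen_iUnion fun p => ((?_ : IsOpen _).inter ?_).inter ?_
    · exact ((isOpen_osBaseC_succ N _).preimage (continuous_dEmbed _)).preimage
        (continuous_splitLeft p)
    · exact isOpen_lt ((continuous_apply p).abs) continuous_const
    · exact ((isOpen_osBaseC_succ N _).preimage (continuous_dEmbed _)).preimage
        (continuous_splitRight p)

/-- The bases `d_j^{(N)}`, `N ≥ 1`, are open. [cite: OsterwalderSchraderCMP1975, Ch. V.2 eq. (5.22)] -/
theorem isOpen_osBaseD_succ (N j : ℕ) : IsOpen (osBaseD (N + 1) j) :=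
  (isOpen_osBaseC_succ N _).preimage (continuous_dEmbed _)

/-- `0 ∈ c_k^{(N)}` for `k ≥ 1`. [cite: OsterwalderSchraderCMP1975, Ch. V.2 eq. (5.25)] -/
theorem zero_mem_osBaseC (N : ℕ) {k : ℕ} (hk : 0 < k) : (0 : Fin k → ℝ) ∈ osBaseC N k :=
  osBaseC_mono hk (Nat.zero_le N) (show (0 : Fin k → ℝ) ∈ osBaseC 0 k from mem_singleton _)

/-- **Lemma 5.2 / Cor. 5.3 for OS's own bases, with the rate (6.30)**: for every `k` there is
`A ≥ 1` such that every `v ∈ ℝ^{k+1}` with `max |v_i| ≤ (π/2)(1 − δ)`, `0 < δ ≤ 1`, lies in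
`c_{k+1}^{(N+1)}` for some `N` with `2^N ≤ A / δ²`. [cite: OsterwalderSchraderCMP1975, Ch. V.2 Lemma 5.2, Cor. 5.3; Ch. VI.2 eq. (6.30)] -/
theorem osBaseC_exists_level (k : ℕ) : ∃ A : ℝ, 1 ≤ A ∧
    ∀ (v : Fin (k + 1) → ℝ) (δ : ℝ), 0 < δ → δ ≤ 1 →
      (∀ i, |v i| ≤ Real.pi / 2 * (1 - δ)) →
        ∃ N : ℕ, v ∈ osBaseC (N + 1) (k + 1) ∧ (2 : ℝ) ^ N ≤ A / δ ^ 2 :=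
  isOSBaseFamily_osBase.exists_level k

/-- **`⋃_N c_k^{(N)}` is exactly the open cube `(−π/2, π/2)ᵏ`** (`k ≥ 1`), i.e.
`⋃_N C_k^{(N)} = ℂ₊ᵏ` (OS II, p. 294 and Lemma 5.2). [cite: OsterwalderSchraderCMP1975, Ch. V.2 Lemma 5.2] -/
theorem iUnion_osBaseC (k : ℕ) :
    ⋃ N, osBaseC N (k + 1) = {v | ∀ i, |v i| < Real.pi / 2} := by
  apply Subset.antisymm
  · exact iUnion_subset fun N => osBaseC_subset_cube N (k + 1)
  · intro v hv
    obtain ⟨N, hN⟩ := isOSBaseFamily_osBase.exists_mem_C_of_forall_abs_lt v hv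
    exact mem_iUnion.2 ⟨N + 1, hN⟩

/-! ### The level `N(ζ)` of a point of `ℂ₊^{k+1}` ((6.30)) -/

/-- **The choice (6.30) of the level at a point of `ℂ₊^{k+1}`**: for every `k` there is `A ≥ 1` such
that for every `ζ ∈ ℂ₊^{k+1}` (`Re ζ_i > 0`) the vector of arguments `(arg ζ_i)_i` lies in
`c_{k+1}^{(N+1)}` for some `N` with `2^N ≤ A (∑ᵢ |ζᵢ| / Re ζᵢ)²` — OS II p. 303: "Choose `s` such
that `|arg ζ_r| ≤ |arg ζ_s|` … `|arg ζ_s| + arcsin(Re ζ_s / |ζ_s|) = π/2` … choose the integer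
`N = N(ζ)` such that [(5.28)] … then by Corollary 5.3, `ζ ∈ C_k^{(N)}`", which inserted in the
bound (6.28) `α^k β^{k²} 2^{2βkN}` gives the polynomial factor of (6.31) = (4.6). Here
`π/2 − |arg ζ_i| ≥ cos (arg ζ_i) = Re ζ_i / |ζ_i|`. [cite: OsterwalderSchraderCMP1975, Ch. VI.2 eq. (6.30); Ch. V.2 Cor. 5.3] -/
theorem osBaseC_exists_level_arg (k : ℕ) : ∃ A : ℝ, 1 ≤ A ∧
    ∀ ζ : Fin (k + 1) → ℂ, (∀ i, 0 < (ζ i).re) →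
      ∃ N : ℕ, (fun i => Complex.arg (ζ i)) ∈ osBaseC (N + 1) (k + 1) ∧
        (2 : ℝ) ^ N ≤ A * (∑ i, ‖ζ i‖ / (ζ i).re) ^ 2 := by
  obtain ⟨A, hA1, hA⟩ := osBaseC_exists_level k
  have hπ2 := Real.two_le_pi
  have hπ := Real.pi_pos
  refine ⟨A * (Real.pi / 2) ^ 2, ?_, fun ζ hζ => ?_⟩
  · have : 1 ≤ (Real.pi / 2) ^ 2 := by nlinarith
    nlinarith
  set T := ∑ i, ‖ζ i‖ / (ζ i).re with hT
  have hterm : ∀ i, 1 ≤ ‖ζ i‖ / (ζ i).re := fun i => by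
    rw [le_div_iff₀ (hζ i), one_mul]; exact Complex.re_le_norm (ζ i)
  have hT1 : 1 ≤ T :=
    (hterm 0).trans (Finset.single_le_sum (fun i _ => zero_le_one.trans (hterm i))
      (Finset.mem_univ 0))
  have hTpos : 0 < T := by linarith
  set δ : ℝ := 2 / Real.pi * T⁻¹ with hδdef
  have hδ : 0 < δ := by positivity
  have hδ1 : δ ≤ 1 := by
    rw [hδdef]
    have h1 : T⁻¹ ≤ 1 := inv_le_one_of_one_le₀ hT1
    have h2 : 2 / Real.pi ≤ 1 := by rw [div_le_one hπ]; linarith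
    calc 2 / Real.pi * T⁻¹ ≤ 1 * 1 := by gcongr
      _ = 1 := one_mul _
  have hv : ∀ i, |Complex.arg (ζ i)| ≤ Real.pi / 2 * (1 - δ) := by
    intro i
    have hz : ζ i ≠ 0 := fun h => by simpa [h] using hζ i
    have hcos : Real.cos (Complex.arg (ζ i)) = (ζ i).re / ‖ζ i‖ := Complex.cos_arg hz
    have habs : |Complex.arg (ζ i)| < Real.pi / 2 :=
      Complex.abs_arg_lt_pi_div_two_iff.2 (Or.inl (hζ i))
    have h1 : Real.cos (Complex.arg (ζ i)) ≤ Real.pi / 2 - |Complex.arg (ζ i)| := by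
      rw [← Real.cos_abs, ← Real.sin_pi_div_two_sub]
      exact Real.sin_le (by linarith)
    have h2 : T⁻¹ ≤ (ζ i).re / ‖ζ i‖ := by
      have hle : ‖ζ i‖ / (ζ i).re ≤ T :=
        Finset.single_le_sum (fun j _ => zero_le_one.trans (hterm j)) (Finset.mem_univ i)
      have hpos : 0 < ‖ζ i‖ / (ζ i).re := by have := hterm i; linarith
      rw [← inv_div]
      exact inv_anti₀ hpos hle
    have h3 : Real.pi / 2 * (1 - δ) = Real.pi / 2 - T⁻¹ := by
      rw [hδdef]; field_simp
    rw [h3]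
    linarith [hcos ▸ h1]
  obtain ⟨N, hN, h2N⟩ := hA _ δ hδ hδ1 hv
  refine ⟨N, hN, h2N.trans (le_of_eq ?_)⟩
  rw [hδdef]
  field_simp


/-! ### Solidity: the bases contain, with a point, the box it spans (OS II p. 296) -/

/-- Reflection of the `i`-th coordinate. [folklore] -/
def coordReflect {k : ℕ} (i : Fin k) (v : Fin k → ℝ) : Fin k → ℝ := Function.update v i (-v i)

/-- Values of a coordinate reflection. [folklore] -/
theorem coordReflect_apply {k : ℕ} (i : Fin k) (v : Fin k → ℝ) (m : Fin k) :
    coordReflect i v m = if m = i then -v m else v m := by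
  simp only [coordReflect, Function.update_apply]
  split_ifs with h
  · rw [h]
  · rfl

/-- The coordinate reflection as a linear map. [folklore] -/
def coordReflectLin {k : ℕ} (i : Fin k) : (Fin k → ℝ) →ₗ[ℝ] (Fin k → ℝ) where
  toFun := coordReflect i
  map_add' v w := by funext m; simp only [coordReflect_apply, Pi.add_apply]; split_ifs <;> ring
  map_smul' c v := by
    funext m; simp only [coordReflect_apply, Pi.smul_apply, smul_eq_mul, RingHom.id_apply]
    split_ifs <;> ring

/-- A set is **reflection-closed** if it is stable under every coordinate reflection. [folklore] -/
def IsReflClosed {k : ℕ} (S : Set (Fin k → ℝ)) : Prop := ∀ (i : Fin k), ∀ v ∈ S, coordReflect i v ∈ S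

/-- The convex hull of a reflection-closed set is reflection-closed. [folklore] -/
theorem isReflClosed_convexHull {k : ℕ} {S : Set (Fin k → ℝ)} (h : IsReflClosed S) :
    IsReflClosed (convexHull ℝ S) := by
  intro i v hv
  have h1 : coordReflect i v ∈ coordReflectLin i '' convexHull ℝ S := ⟨v, hv, rfl⟩
  rw [(coordReflectLin i).image_convexHull] at h1
  refine convexHull_mono ?_ h1
  rintro _ ⟨w, hw, rfl⟩
  exact h i w hw

/-- **A convex reflection-closed set is solid**: with `v` it contains every `w` with
`|wᵢ| ≤ |vᵢ|` (OS II p. 296: "if `(v₁, …, v_k) ∈ c_k^{(N)}` then the whole hyperrectangle with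
corners `(±v₁, …, ±v_k)` is also contained in `c_k^{(N)}`"). [cite: OsterwalderSchraderCMP1975, Ch. V.2 p. 296] -/
theorem solid_of_convex_of_isReflClosed {k : ℕ} {S : Set (Fin k → ℝ)} (hS : Convex ℝ S)
    (hR : IsReflClosed S) {v w : Fin k → ℝ} (hv : v ∈ S) (hw : ∀ i, |w i| ≤ |v i|) : w ∈ S := by
  -- replace the coordinates of `v` by those of `w` one at a time
  suffices H : ∀ m : ℕ, ∀ w : Fin k → ℝ, (∀ i : Fin k, (i : ℕ) < m → |w i| ≤ |v i|) →
      (∀ i : Fin k, m ≤ (i : ℕ) → w i = v i) → w ∈ S by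
    exact H k w (fun i _ => hw i) fun i hi => absurd i.2 (not_lt.2 hi)
  intro m
  induction m with
  | zero =>
    intro w _ h2
    have : w = v := funext fun i => h2 i (Nat.zero_le _)
    rw [this]; exact hv
  | succ m ih =>
    intro w h1 h2
    by_cases hm : m < k
    · set i₀ : Fin k := ⟨m, hm⟩ with hi₀
      -- the two neighbours with the `m`-th coordinate `± v_m`
      set wp : Fin k → ℝ := Function.update w i₀ (v i₀) with hwp
      have hwp_mem : wp ∈ S := by
        refine ih wp (fun i hi => ?_) (fun i hi => ?_)
        · have hne : i ≠ i₀ := fun h => by rw [h] at hi; exact lt_irrefl _ hi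
          rw [hwp, Function.update_of_ne hne]
          exact h1 i (by omega)
        · by_cases hi' : i = i₀
          · rw [hi', hwp, Function.update_self]
          · rw [hwp, Function.update_of_ne hi']
            refine h2 i ?_
            have : (i : ℕ) ≠ m := fun h => hi' (Fin.ext (by rw [h]))
            omega
      have hwm_mem : coordReflect i₀ wp ∈ S := hR i₀ wp hwp_mem
      -- `w` is a convex combination of `wp` and its reflection
      have habs : |w i₀| ≤ |v i₀| := h1 i₀ (by simp [hi₀])
      by_cases hv0 : v i₀ = 0
      · have hw0 : w i₀ = 0 := by rw [hv0, abs_zero, abs_nonpos_iff] at habs; exact habs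
        have : w = wp := by
          funext i
          by_cases hi : i = i₀
          · rw [hi, hwp, Function.update_self, hv0, hw0]
          · rw [hwp, Function.update_of_ne hi]
        rw [this]; exact hwp_mem
      · set t : ℝ := (1 + w i₀ / v i₀) / 2 with ht
        have hq : |w i₀ / v i₀| ≤ 1 := by
          rw [abs_div, div_le_one (abs_pos.2 hv0)]; exact habs
        have hq' := abs_le.1 hq
        have ht0 : 0 ≤ t := by rw [ht]; linarith [hq'.1]
        have ht1 : 0 ≤ 1 - t := by rw [ht]; linarith [hq'.2]
        have hcomb := hS hwp_mem hwm_mem ht0 ht1 (by ring)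
        convert hcomb using 1
        funext i
        simp only [Pi.add_apply, Pi.smul_apply, smul_eq_mul, coordReflect_apply]
        by_cases hi : i = i₀
        · rw [if_pos hi, hi, hwp, Function.update_self, ht]
          field_simp
          ring
        · rw [if_neg hi, hwp, Function.update_of_ne hi]
          ring
    · -- no new coordinate: the hypotheses already give stage `m`
      exact ih w (fun i hi => h1 i (by omega)) fun i hi => h2 i (by omega)

/-- A coordinate reflection does not change the moduli of the coordinates. [folklore] -/
theorem abs_coordReflect_apply {k : ℕ} (i : Fin k) (v : Fin k → ℝ) (m : Fin k) :
    |coordReflect i v m| = |v m| := by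
  rw [coordReflect_apply]; split_ifs <;> simp

/-- The moduli of the coordinates of `(−ũ, 0, u)` only depend on those of `u`. [folklore] -/
theorem abs_dEmbed_apply_congr {j : ℕ} {u u' : Fin j → ℝ} (h : ∀ i, |u' i| = |u i|)
    (m : Fin (j + 1 + j)) : |dEmbed u' m| = |dEmbed u m| := by
  simp only [dEmbed]
  split_ifs
  · rw [abs_neg, abs_neg, h]
  · rfl
  · rw [h]

/-- The `d`-bases of a convex reflection-closed `c`-family are reflection-closed. [folklore] -/
theorem isReflClosed_osBaseD_of {N j : ℕ} (hc : Convex ℝ (osBaseC N (j + 1 + j)))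
    (h : IsReflClosed (osBaseC N (j + 1 + j))) : IsReflClosed (osBaseD N j) := by
  intro i u hu
  rw [mem_osBaseD_iff] at hu ⊢
  exact solid_of_convex_of_isReflClosed hc h hu fun m =>
    (abs_dEmbed_apply_congr (abs_coordReflect_apply i u) m).le

/-- The generating set built from reflection-closed `d`'s is reflection-closed. [folklore] -/
theorem isReflClosed_osGen {D : (j : ℕ) → Set (Fin j → ℝ)} (hD : ∀ j, IsReflClosed (D j))
    (k : ℕ) : IsReflClosed (osGen D k) := by
  rintro i v ⟨p, h1, h2, h3⟩
  have hp := p.2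
  have hi := i.2
  refine ⟨p, ?_, ?_, ?_⟩
  · -- left part
    rcases lt_or_ge (i : ℕ) p with hip | hip
    · have e : splitLeft (coordReflect i v) p = coordReflect ⟨p - 1 - i, by omega⟩ (splitLeft v p) := by
        funext m
        have hm := m.2
        simp only [splitLeft, coordReflect_apply, Fin.ext_iff]
        split_ifs with ha hb hb
        · rfl
        · exfalso; apply hb; omega
        · exfalso; apply ha; omega
        · rfl
      rw [e]; exact hD _ _ _ h1
    · have e : splitLeft (coordReflect i v) p = splitLeft v p := by
        funext m
        have hm := m.2
        simp only [splitLeft, coordReflect_apply, Fin.ext_iff]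
        rw [if_neg (by omega)]
      rw [e]; exact h1
  · rw [coordReflect_apply]
    split_ifs
    · rwa [abs_neg]
    · exact h2
  · rcases lt_or_ge (p : ℕ) i with hip | hip
    · have e : splitRight (coordReflect i v) p =
          coordReflect ⟨i - p - 1, by omega⟩ (splitRight v p) := by
        funext m
        have hm := m.2
        simp only [splitRight, coordReflect_apply, Fin.ext_iff]
        split_ifs with ha hb hb
        · rfl
        · exfalso; apply hb; omega
        · exfalso; apply ha; omega
        · rfl
      rw [e]; exact hD _ _ _ h3
    · have e : splitRight (coordReflect i v) p = splitRight v p := by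
        funext m
        have hm := m.2
        simp only [splitRight, coordReflect_apply, Fin.ext_iff]
        rw [if_neg (by omega)]
      rw [e]; exact h3

/-- **OS's bases are reflection-closed** at every level. [cite: OsterwalderSchraderCMP1975, Ch. V.2 p. 296] -/
theorem isReflClosed_osBaseC : ∀ N k : ℕ, IsReflClosed (osBaseC N k)
  | 0, k => by
    intro i v hv
    rw [osBaseC_zero, mem_singleton_iff] at hv ⊢
    subst hv
    funext m; simp [coordReflect_apply]
  | N + 1, k => by
    rw [osBaseC_succ]
    exact isReflClosed_convexHull (isReflClosed_osGen (fun j =>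
      isReflClosed_osBaseD_of (isOSBaseFamily_osBase.convex N _) (isReflClosed_osBaseC N _)) k)

/-- The `d`-bases are reflection-closed. [cite: OsterwalderSchraderCMP1975, Ch. V.2 p. 296] -/
theorem isReflClosed_osBaseD (N j : ℕ) : IsReflClosed (osBaseD N j) :=
  isReflClosed_osBaseD_of (isOSBaseFamily_osBase.convex N _) (isReflClosed_osBaseC N _)

/-- **Solidity of `c_k^{(N)}`**: with `v`, the base contains every `w` with `|wᵢ| ≤ |vᵢ|` (the
closed box with corners `(±v₁, …, ±v_k)`; OS II p. 296). [cite: OsterwalderSchraderCMP1975, Ch. V.2 p. 296] -/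
theorem osBaseC_solid {N k : ℕ} {v w : Fin k → ℝ} (hv : v ∈ osBaseC N k)
    (hw : ∀ i, |w i| ≤ |v i|) : w ∈ osBaseC N k :=
  solid_of_convex_of_isReflClosed (isOSBaseFamily_osBase.convex N k) (isReflClosed_osBaseC N k) hv hw

/-- The `d`-bases are convex. [folklore] -/
theorem convex_osBaseD (N j : ℕ) : Convex ℝ (osBaseD N j) := by
  intro u hu u' hu' a b ha hb hab
  rw [mem_osBaseD_iff] at hu hu' ⊢
  have hlin : dEmbed (a • u + b • u') = a • dEmbed u + b • dEmbed u' := by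
    funext m
    simp only [dEmbed, Pi.add_apply, Pi.smul_apply, smul_eq_mul]
    split_ifs <;> ring
  rw [hlin]
  exact isOSBaseFamily_osBase.convex N _ hu hu' ha hb hab

/-- **Solidity of `d_j^{(N)}`** (OS II p. 294: with `(x, ζ)` "the whole cone of points `(x, ζ')`
with `|arg ζ'ᵢ| ≤ |arg ζᵢ|` is contained in `D_n^{(N)}`"). [cite: OsterwalderSchraderCMP1975, Ch. V.2 pp. 294, 296] -/
theorem osBaseD_solid {N j : ℕ} {v w : Fin j → ℝ} (hv : v ∈ osBaseD N j)
    (hw : ∀ i, |w i| ≤ |v i|) : w ∈ osBaseD N j :=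
  solid_of_convex_of_isReflClosed (convex_osBaseD N j) (isReflClosed_osBaseD N j) hv hw


/-! ### Star-shapedness of the generating sets (the input shape of the tube theorem) -/

/-- Each piece of the generating set (fixed position `p` of the free slot) is convex when the
`d`'s are convex. [folklore] -/
theorem convex_osGen_piece {D : (j : ℕ) → Set (Fin j → ℝ)} (hD : ∀ j, Convex ℝ (D j)) {k : ℕ}
    (p : Fin k) :
    Convex ℝ {v : Fin k → ℝ | splitLeft v p ∈ D p ∧ |v p| < Real.pi / 2 ∧
      splitRight v p ∈ D (k - 1 - p)} := by
  intro v hv w hw a b ha hb hab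
  refine ⟨?_, ?_, ?_⟩
  · have hlin : splitLeft (a • v + b • w) p = a • splitLeft v p + b • splitLeft w p := by
      funext i; simp only [splitLeft, Pi.add_apply, Pi.smul_apply, smul_eq_mul]; ring
    rw [hlin]; exact hD _ hv.1 hw.1 ha hb hab
  · have h := convex_cube 1 (Real.pi / 2) (x := fun _ => v p) (y := fun _ => w p)
      (fun _ => hv.2.1) (fun _ => hw.2.1) ha hb hab (0 : Fin 1)
    simpa using h
  · have hlin : splitRight (a • v + b • w) p = a • splitRight v p + b • splitRight w p := by
      funext i; simp only [splitRight, Pi.add_apply, Pi.smul_apply, smul_eq_mul]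
    rw [hlin]; exact hD _ hv.2.2 hw.2.2 ha hb hab

/-- `0` lies in every piece of the generating set built from OS's bases. [cite: OsterwalderSchraderCMP1975, Ch. V.2 eq. (5.25)] -/
theorem zero_mem_osGen_piece (N : ℕ) {k : ℕ} (p : Fin k) :
    (0 : Fin k → ℝ) ∈ {v : Fin k → ℝ | splitLeft v p ∈ osBaseD N p ∧ |v p| < Real.pi / 2 ∧
      splitRight v p ∈ osBaseD N (k - 1 - p)} := by
  refine ⟨?_, by simpa using Real.pi_pos, ?_⟩
  · rw [splitLeft_zero]; exact isOSBaseFamily_osBase.zero_mem_D N _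
  · rw [splitRight_zero]; exact isOSBaseFamily_osBase.zero_mem_D N _

/-- **The generating set of level `N + 1` is star-shaped with respect to `0`** (a finite union of
convex sets containing `0`) — the shape required of the base of the tube from which Bochner's
theorem extends to the convex hull `c_k^{(N+1)}`. [cite: OsterwalderSchraderCMP1975, Ch. V.2 eqs. (5.22)–(5.23)] -/
theorem starConvex_osGen_osBaseD (N k : ℕ) : StarConvex ℝ (0 : Fin k → ℝ) (osGen (osBaseD N) k) := by
  rw [osGen_eq_iUnion]
  refine starConvex_iUnion fun p => ?_
  have hc : Convex ℝ (((fun v => splitLeft v p) ⁻¹' osBaseD N p ∩ {v | |v p| < Real.pi / 2}) ∩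
      (fun v => splitRight v p) ⁻¹' osBaseD N (k - 1 - p)) := by
    have h := convex_osGen_piece (fun j => convex_osBaseD N j) p
    convert h using 1
    ext v; simp only [mem_inter_iff, mem_preimage, mem_setOf_eq, and_assoc]
  refine hc.starConvex ?_
  have h0 := zero_mem_osGen_piece N p
  simp only [mem_setOf_eq] at h0
  exact ⟨⟨h0.1, h0.2.1⟩, h0.2.2⟩

/-- `0` lies in the generating set of every level (`k ≥ 1`). [cite: OsterwalderSchraderCMP1975, Ch. V.2 eq. (5.25)] -/
theorem zero_mem_osGen_osBaseD (N : ℕ) {k : ℕ} (hk : 0 < k) :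
    (0 : Fin k → ℝ) ∈ osGen (osBaseD N) k :=
  ⟨⟨0, hk⟩, zero_mem_osGen_piece N ⟨0, hk⟩⟩

/-- The generating set lies in the next base: `osGen (d^{(N)}) ⊆ c^{(N+1)}`. [cite: OsterwalderSchraderCMP1975, Ch. V.2 eq. (5.23)] -/
theorem osGen_subset_osBaseC_succ (N k : ℕ) : osGen (osBaseD N) k ⊆ osBaseC (N + 1) k := by
  rw [osBaseC_succ]; exact subset_convexHull ℝ _

/-- The generating sets lie in the open cube. [cite: OsterwalderSchraderCMP1975, Ch. V.2 eq. (5.22)] -/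
theorem osGen_subset_cube (N k : ℕ) : osGen (osBaseD N) k ⊆ {v | ∀ i, |v i| < Real.pi / 2} :=
  (osGen_subset_osBaseC_succ N k).trans (osBaseC_subset_cube (N + 1) k)

/-- The generating sets of level `≥ 2` are open. [cite: OsterwalderSchraderCMP1975, Ch. V.2 eq. (5.22)] -/
theorem isOpen_osGen_osBaseD_succ (N k : ℕ) : IsOpen (osGen (osBaseD (N + 1)) k) := by
  rw [osGen_eq_iUnion]
  refine isOpen_iUnion fun p => ((?_ : IsOpen _).inter ?_).inter ?_
  · exact (isOpen_osBaseD_succ N _).preimage (continuous_splitLeft p)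
  · exact isOpen_lt ((continuous_apply p).abs) continuous_const
  · exact (isOpen_osBaseD_succ N _).preimage (continuous_splitRight p)

end Literature.MathematicalPhysics.QuantumFieldTheory.OSEnvelope
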